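import Literature.NumberTheory.Automorphic.FuchsianKloostermanSums
import Literature.NumberTheory.Automorphic.FuchsianEisensteinSeries
import Literature.NumberTheory.Automorphic.FuchsianCuspZones
import Literature.NumberTheory.Automorphic.FuchsianIncompleteEisensteinCusp
import HarnessLib

/-!
# Poincaré series of a cusp pair and the Fourier modes at a cusp: Iwaniec's (3.1) and (3.17)
(Iwaniec, *Spectral Methods of Automorphic Forms*, GSM 53, §2.4 (2.16)–(2.21) & Theorem 2.7, §2.5
(2.23), §3.1 (3.1), §3.2 (the Selberg series `E_𝔞m(z|ψ)`, (3.9)), §3.4 (3.17); PDF pp. 34–36, 40, 42, 45–46)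

The general **Poincaré series** `E_𝔞(z | p) = Σ_{γ ∈ Γ_𝔞 \ Γ} p(σ_𝔞⁻¹γz)` of a `1`-periodic generating
function `p` (Iwaniec (3.1)) for a GENERAL discrete `Γ ≤ SL₂(ℝ)` (inside `GL₂(ℝ)`) with `-1 ∈ Γ` at a
cusp `𝔞 = σ_𝔞∞` of width one, read in the frame of a second cusp `𝔟 = σ_𝔟∞` as a sum over the rows of
the double-coset space `B \ σ_𝔞⁻¹Γσ_𝔟` of `FuchsianKloostermanSums.lean`, and **the unfolding of its
Fourier modes along a horocycle at `𝔟`** — Iwaniec's (3.17) with the Kloosterman sums `S_𝔞𝔟` —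
the formula through which Kloosterman sums enter the spectral theory (Fourier coefficients of
Eisenstein and Poincaré series, Theorem 3.4; the Selberg–Kuznetsov circle, Chapter 9; Motohashi's
Lemma 2.1). Everything is PROVED; no fact is introduced.

1. (§1) `pairRows σ_𝔞 σ_𝔟` (the bottom rows of `σ_𝔞⁻¹Γσ_𝔟`), a chosen lift `rowLift`, and **two
   elements with the same row differ by `±T_k`, `k ∈ ℤ`, on the left** (`exists_eq_pm_translSL_mul`;
   also for `c = 0`; needs `-1 ∈ Γ`), whence **`p(ω w)` depends only on the row** for `1`-periodic
   `p` (`gen_smul_eq_of_row_eq`); the rows of the conjugated group `= pairRows σ_𝔞 σ_𝔞`, and the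
   bijections `pairRows σ_𝔞 σ_𝔞 ≃ pairRows σ_𝔞 σ_𝔟` (`r ↦ r σ_𝔞⁻¹σ_𝔟`), `r ↦ r δ` (`δ ∈ σ_𝔟⁻¹Γσ_𝔟`).
2. (§2) **`poincarePair σ_𝔞 σ_𝔟 p w = E_𝔞(σ_𝔟 w | p) = ½ Σ_{rows r} p(ω_r w)`** and
   **`poincare σ_𝔞 p z = E_𝔞(z | p)`**; absolute convergence for `|p(v)| ≤ C (Im v)^σ`, `σ > 1`
   (`summable_norm_poincarePair`, Lemma 2.10 via `summable_rowIm_rpow`, transported); invariance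
   under `σ_𝔟⁻¹Γσ_𝔟` (`poincarePair_smul`), the frame change `E_𝔞(σ_𝔟 w | p) = poincarePair σ_𝔞 σ_𝔟 p w`
   (`poincare_sigma_smul`) and **automorphy** (`isAutomorphic_poincare`); the bound `norm_poincarePair_le`.
3. (§3) Tools: Harnack comparison of heights for `SL₂(ℝ)`, the rows `-r` and `(c, d + kc)`
   (`gen_rowLift_neg`, `gen_rowLift_translate`: `p(ω_{(c,d+kc)} w) = p(ω_{(c,d)}(w + k))`), and the
   unfolding `Σ_{k ∈ ℤ} ∫₀¹ F(x + k) dx = ∫_ℝ F` (`hasSum_intervalIntegral_comp_add_int`).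
4. (§4) Countability of `σ_𝔞⁻¹Γσ_𝔟`; the partition of the rows into `c = 0` / `c > 0` / `c < 0`
   (`zeroRows`, `posRows`, `negRows ≃ posRows`), the **reduced rows** `redRows = {(c, d) : c ∈ 𝒞_𝔞𝔟,
   d ∈ bottomReps c}` (the double cosets `B \ σ_𝔞⁻¹Γσ_𝔟 / B` of Theorem 2.7, `mem_redRows_iff`) and
   **`redRows × ℤ ≃ posRows`, `((c,d),k) ↦ (c, d + kc)`** (`redRowsProdEquiv`).
5. (§5) **The unfolded mode formula for a general bounded continuous `1`-periodic weight `φ`**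
   (`intervalIntegral_poincarePair_mul_eq`):
   `∫₀¹ E_𝔞(σ_𝔟(x + w₀) | p) φ(x) dx = ½ Σ_{c = 0 rows} ∫₀¹ p(ω_r(x + w₀))φ + Σ_{(c,d) reduced} ∫_ℝ p(ω_{(c,d)}(t + w₀)) φ(t) dt`
   — the interchange by `integral_tsum` (uniform domination on the segment through the Harnack
   bound), the `c < 0` rows doubling the `c > 0` ones, `Summable.tsum_prod'` over `redRows × ℤ`, and
   the `ℤ`-sum unfolding the period integral (integrability along the horocycle from a Cauchy
   majorant `(1 + u²)⁻¹`).
6. (§6) The `c = 0` rows: `= {(0, ±1)}` at the same cusp (`zeroRows_self_eq`, no dilations), where the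
   summand is `p` itself, so the diagonal term is `∫₀¹ p(x + w₀) φ` (`intervalIntegral_poincarePair_self_mul_eq`);
   `= ∅` when `σ_𝔞⁻¹Γσ_𝔟` has no upper-triangular element (`…_of_offdiag`).
8. (§8, `Unfolding`) **`∫_F E_𝔞(z | p) f(z) dμ = ∫_ℍ 𝟙_P(w) p(w) f(σ_𝔞 w) dμ(w) = ∫₀^∞ y⁻² ∫₀¹ p f∘σ_𝔞 dx dy`**
   for `f` automorphic and the strip function integrable (`setIntegral_poincare_mul(_eq_iterated)`,
   through `tsum_indicator_strip_eq` / `setIntegral_tsum_smul_eq` of the Eisenstein files), the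
   integrability of the Selberg strip function for bounded `f ∘ σ_𝔞` and `∫₀^∞|ψ|e^{-2πmy}y⁻² < ∞`, and
   **Motohashi's (2.1.7)**: `∫_F E_𝔞m(z|ψ) f(z) dμ = ∫₀^∞ ψ(y)e^{-2πmy} (∫₀¹ f(σ_𝔞(x+iy)) e(mx) dx) y⁻² dy`
   (`setIntegral_poincare_selbergGen_mul`; the inner integral is the `(-m)`-th Fourier mode of `f` at `𝔞`).
7. (§7) **Selberg's `p(z) = ψ(y) e(mz)`** (`selbergGen`; `m ≥ 0`, `|ψ(u)| ≤ Cu^σ`): the Möbius action on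
   the horocycle `ω(t + iy) = a/c - 1/(c(c(t+iy) + d))`, the shift `t ↦ t - d/c`
   (`integral_selbergGen_smul_mul`: `∫_ℝ p(ω(t+iy)) e(-nt) dt = e((ma + nd)/c) I_c(y)`,
   `I_c(y) = poincareModeIntegral = ∫_ℝ ψ(yc⁻²/(t²+y²)) e(-mc⁻²/(t+iy) - nt) dt`), the phase as a term
   of the Kloosterman sum, regrouping by the modulus (`tsum_integral_redRows_selbergGen`), and
   **Iwaniec (3.17) for the modes**:
   `∫₀¹ E_𝔞m(σ_𝔟(x+iy)|ψ) e(-nx) dx = δ_𝔞𝔟 δ_{mn} ψ(y)e^{-2πmy} + Σ_{c ∈ 𝒞_𝔞𝔟} S_𝔞𝔟(n,m;c) I_c(y)`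
   (`fourierMode_poincarePair_selbergGen_self` / `…_of_offdiag`).

CONVENTION NOTE (documented at `cexp_phase_eq_kloostermanTerm`): the tree's `cuspKloosterman σ_𝔞 σ_𝔟 m n c
= Σ e((md + na)/c)` is (2.23) as printed; the phase produced by the unfolding is `e((ma + nd)/c)`, i.e.
the summand of `cuspKloosterman σ_𝔞 σ_𝔟 n m c` — the book's "`S_𝔞𝔟(m,n;c)`" in (3.17)/(3.22) tacitly
uses the transposed convention `e((am + dn)/c)` of Deshouillers–Iwaniec / Iwaniec–Kowalski. Our
statements carry the tree's sums with the arguments `(n, m)`.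

Not here: the evaluation of `I_c(y)` ((3.18)–(3.19), Bessel functions; Motohashi (2.1.8)–(2.1.13)),
pointwise convergence of the Fourier series (3.17) itself, `m < 0`; the combination of §8 with
Theorem 3.1 (`MaassFormWhittakerModes`) and `∫₀^∞ y^{μ-1}e^{-y}K_ν = …` (`BesselKExpMellin`) into
Motohashi's (2.1.18) `⟨E_𝔞m(·|y^s), u_j⟩ = √π(4πm)^{1/2-s} ρ̄_{𝔞j}(m) Γ(s-½+it_j)Γ(s-½-it_j)/Γ(s)` (next file).

## References
* [Iwaniec2002] H. Iwaniec, *Spectral Methods of Automorphic Forms*, 2nd ed., GSM 53, AMS 2002,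
  §2.4 (2.16)–(2.21) & Thm 2.7, §2.5 (2.23), PDF pp. 34–36; §3.1 (3.1), PDF p. 40; §3.2 (3.9) and
  the display before (3.10), PDF p. 42; §3.4 (3.17), PDF pp. 45–46
  (held copy `book:iwaniec2002-spectral-methods-automorphic-forms`).
* [Motohashi1997] Y. Motohashi, *Spectral Theory of the Riemann Zeta-Function*, CUP 1997, (1.1.5)–(1.1.6)
  and §2.1 (2.1.7)–(2.1.8) (the same unfolding for `SL₂(ℤ)`).

Mathlib: `integral_tsum`, `Summable.tsum_union_disjoint`, `Summable.tsum_prod'`, `Summable.prod`,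
`Summable.tsum_sigma'`, `summable_subtype_iff_indicator`, `tsum_congr_set_coe`, `hasSum_integral_iUnion`,
`iUnion_Ioc_add_intCast`, `pairwise_disjoint_Ioc_add_intCast`, `intervalIntegral.integral_comp_add_right`,
`integral_sub_right_eq_self`, `integrable_inv_one_add_sq`, `Integrable.comp_mul_left'`, `integral_exp_mul_complex`,
`UpperHalfPlane.dist_eq`, `UpperHalfPlane.im_le_im_mul_exp_dist`, `UpperHalfPlane.neg_smul`,
`UpperHalfPlane.coe_specialLinearGroup_apply`, `Set.ncard_pair`, `Int.floor_eq_iff`, `Integrable.mul_prod`,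
`MeasurePreserving.integrableOn_comp_preimage`, `Complex.volume_preserving_equiv_real_prod`.
Literature: `cuspPairSet`, `kloostermanModuli`, `bottomEntries`, `bottomReps`, `topLeft`, `kloostermanTerm`,
`cuspKloosterman`, `cuspKloosterman_eq_sum`, `finite_bottomReps`, `kloostermanTerm_eq_of_mem`, `mul_translSL_mem`,
`mul_translSL_apply`, `mul_inv_apply_10`, `neg_mem_cuspPairSet_iff`, `toGL_mem_conj_iff_mem_cuspPairSet`,
`mem_conj_iff_exists` (`FuchsianKloostermanSums`); `tsum_indicator_strip_eq`, `conjEquiv`, `coe_conjEquiv`,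
`integrable_comp_sl_inv_smul`, `integral_comp_sl_inv_smul`, `continuousOn_comp_ofComplex`, `cuspStrip`
(`FuchsianIncompleteEisenstein(Cusp)`); `setIntegral_tsum_smul_eq`, `IsHypFundamentalDomain`
(`FundamentalDomainUnfolding`); `integral_upperHalfPlane_eq_integral_complex`,
`integrable_upperHalfPlane_iff_integrableOn_complex`, `setIntegral_upperHalf_eq_iterated` (`InvariantIntegralOperators`); `rows`, `rowIm`, `rowIm_vecMul`, `im_smul_eq_rowIm`,
`normSq_rowDenom`, `summable_rowIm_rpow`, `eq_upperRightHom_or_neg_of_upperTriangular`, `isCusp_infty_of_mem`,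
`conj_le_range`, `IsDiscreteSubgroup.conj`, `neg_one_mem_conj_iff`, `translSL`, `toGL_translSL`, `toGL_neg`,
`toGL_smul_eq` (`FuchsianGroupCusps`); `upperRightHom_smul` (`FuchsianCuspZones`); `IsAutomorphic`
(`HyperbolicLaplaceSpectrum`). Tree search (`lean search 'poincare|Poincare' --decl`): only Poincaré DUALITY
(algebraic geometry / topology); no Poincaré series.
-/

noncomputable section

namespace Literature.NumberTheory.Automorphic

open Matrix UpperHalfPlane
open scoped MatrixGroups

namespace Fuchsian

variable {Γ : Subgroup (GL (Fin 2) ℝ)}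

/-! ## 1. Rows of `σ_𝔞⁻¹ Γ σ_𝔟` and lifts -/

section PairRows

open scoped Pointwise

variable (Γ) in
/-- The bottom rows `(c, d)` of the elements of `σ_𝔞⁻¹ Γ σ_𝔟` — in bijection with
`B \ σ_𝔞⁻¹ Γ σ_𝔟` up to sign (Iwaniec (2.16)–(2.21)). [cite: Iwaniec2002, §2.4 (2.16)–(2.21), PDF pp. 34–35] -/
def pairRows (σa σb : SL(2, ℝ)) : Set (Fin 2 → ℝ) :=
  (fun ω : SL(2, ℝ) => (ω : Matrix (Fin 2) (Fin 2) ℝ) 1) '' cuspPairSet Γ σa σb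

variable (Γ) in
/-- A chosen element `ω ∈ σ_𝔞⁻¹ Γ σ_𝔟` with the bottom row `r` (and `1` if there is none). The
Poincaré series does not depend on the choice (`gen_rowLift_smul_eq`). [folklore] -/
def rowLift (σa σb : SL(2, ℝ)) (r : Fin 2 → ℝ) : SL(2, ℝ) := by
  classical
  exact if h : ∃ ω ∈ cuspPairSet Γ σa σb, (ω : Matrix (Fin 2) (Fin 2) ℝ) 1 = r then h.choose else 1

/-- The defining property of the lift of a row. [folklore] -/
theorem rowLift_mem_and_row {σa σb : SL(2, ℝ)} {r : Fin 2 → ℝ} (hr : r ∈ pairRows Γ σa σb) :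
    rowLift Γ σa σb r ∈ cuspPairSet Γ σa σb ∧ (rowLift Γ σa σb r : Matrix (Fin 2) (Fin 2) ℝ) 1 = r := by
  classical
  obtain ⟨ω, hω, hωr⟩ := hr
  have h : ∃ ω ∈ cuspPairSet Γ σa σb, (ω : Matrix (Fin 2) (Fin 2) ℝ) 1 = r := ⟨ω, hω, hωr⟩
  have hdef : rowLift Γ σa σb r = h.choose := by
    unfold rowLift; rw [dif_pos h]
  rw [hdef]
  exact h.choose_spec

/-- The bottom row of an element of `SL₂(ℝ)` is not zero. [folklore] -/
theorem row_ne_zero (ω : SL(2, ℝ)) : (ω : Matrix (Fin 2) (Fin 2) ℝ) 1 ≠ 0 := by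
  intro h
  have hdet := ω.prop
  rw [Matrix.det_fin_two, show (ω : Matrix (Fin 2) (Fin 2) ℝ) 1 0 = 0 from congr_fun h 0,
    show (ω : Matrix (Fin 2) (Fin 2) ℝ) 1 1 = 0 from congr_fun h 1] at hdet
  simp at hdet

/-- A row of `σ_𝔞⁻¹ Γ σ_𝔟` is not zero. [folklore] -/
theorem ne_zero_of_mem_pairRows {σa σb : SL(2, ℝ)} {r : Fin 2 → ℝ} (hr : r ∈ pairRows Γ σa σb) : r ≠ 0 := by
  obtain ⟨ω, -, rfl⟩ := hr
  exact row_ne_zero ω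

/-- The height of a nonzero row in terms of the `SL₂(ℝ)` action: `Im ω w = rowIm (row ω) w`. [folklore] -/
theorem im_sl_smul_eq_rowIm (ω : SL(2, ℝ)) (w : ℍ) :
    (ω • w).im = rowIm ((ω : Matrix (Fin 2) (Fin 2) ℝ) 1) w := by
  rw [← toGL_smul_eq, im_smul_eq_rowIm ⟨ω, rfl⟩]
  rfl

/-- The translation `T_k` shifts the real part: `(T_k ω) • w = k +ᵥ (ω • w)`. [folklore] -/
theorem translSL_mul_smul (k : ℝ) (ω : SL(2, ℝ)) (w : ℍ) :
    (translSL k * ω) • w = k +ᵥ (ω • w) := by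
  rw [mul_smul, ← toGL_smul_eq (translSL k), toGL_translSL, upperRightHom_smul]

/-- `(-ω) • w = ω • w` for the action of `SL₂(ℝ)` on `ℍ`. [folklore] -/
theorem neg_sl_smul (ω : SL(2, ℝ)) (w : ℍ) : (-ω) • w = ω • w := by
  rw [← toGL_smul_eq, ← toGL_smul_eq, toGL_neg, UpperHalfPlane.neg_smul]

/-- **Two elements of `σ_𝔞⁻¹ Γ σ_𝔟` with the same bottom row differ by `± T_k`, `k ∈ ℤ`, on the
left** (also for `c = 0`): for `Γ ≤ SL₂(ℝ)` discrete with `-1 ∈ Γ` and `σ_𝔞⁻¹Γσ_𝔞` of periods `ℤ`.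
[cite: Iwaniec2002, §2.4 ("the stability group … acts on the left"), PDF p. 35] -/
theorem exists_eq_pm_translSL_mul
    (hΓ : Γ ≤ (Matrix.SpecialLinearGroup.toGL : SL(2, ℝ) →* GL (Fin 2) ℝ).range)
    (hd : IsDiscreteSubgroup Γ) (hneg : (-1 : GL (Fin 2) ℝ) ∈ Γ) {σa σb : SL(2, ℝ)}
    (hper : (ConjAct.toConjAct (Matrix.SpecialLinearGroup.toGL σa : GL (Fin 2) ℝ)⁻¹ • Γ).strictPeriods =
      AddSubgroup.zmultiples (1 : ℝ))
    {ω ω' : SL(2, ℝ)} (hω : ω ∈ cuspPairSet Γ σa σb) (hω' : ω' ∈ cuspPairSet Γ σa σb)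
    (hrow : (ω' : Matrix (Fin 2) (Fin 2) ℝ) 1 = (ω : Matrix (Fin 2) (Fin 2) ℝ) 1) :
    ∃ k : ℤ, ω' = translSL k * ω ∨ ω' = -(translSL k * ω) := by
  set Γa : Subgroup (GL (Fin 2) ℝ) :=
    ConjAct.toConjAct (Matrix.SpecialLinearGroup.toGL σa : GL (Fin 2) ℝ)⁻¹ • Γ with hΓa
  have hΓa_le : Γa ≤ (Matrix.SpecialLinearGroup.toGL : SL(2, ℝ) →* GL (Fin 2) ℝ).range := by
    have h := conj_le_range hΓ σa⁻¹
    rwa [map_inv] at h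
  have hΓa_d : IsDiscreteSubgroup Γa := hd.conj _
  have hΓa_neg : (-1 : GL (Fin 2) ℝ) ∈ Γa := by
    rw [hΓa, ← map_inv]; exact (neg_one_mem_conj_iff _).mpr hneg
  have hT1 : Matrix.GeneralLinearGroup.upperRightHom (1 : ℝ) ∈ Γa := by
    rw [← Subgroup.mem_strictPeriods_iff, hper]; exact AddSubgroup.mem_zmultiples 1
  have hinf : IsCusp OnePoint.infty Γa := isCusp_infty_of_mem hT1
  have hmem : (Matrix.SpecialLinearGroup.toGL (ω' * ω⁻¹) : GL (Fin 2) ℝ) ∈ Γa :=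
    toGL_mem_conj_iff_mem_cuspPairSet.2 (mul_inv_mem_cuspPairSet hω hω')
  have h10 : (ω' : Matrix (Fin 2) (Fin 2) ℝ) 1 0 = (ω : Matrix (Fin 2) (Fin 2) ℝ) 1 0 := congr_fun hrow 0
  have h11 : (ω' : Matrix (Fin 2) (Fin 2) ℝ) 1 1 = (ω : Matrix (Fin 2) (Fin 2) ℝ) 1 1 := congr_fun hrow 1
  have h0 : (ω' * ω⁻¹) 1 0 = 0 := by
    rw [mul_inv_apply_10]
    have e10 : ω' 1 0 = ω 1 0 := h10
    have e11 : ω' 1 1 = ω 1 1 := h11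
    rw [e10, e11]; ring
  have h0' : (Matrix.SpecialLinearGroup.toGL (ω' * ω⁻¹) : GL (Fin 2) ℝ) 1 0 = 0 := by
    show ((Matrix.SpecialLinearGroup.toGL (ω' * ω⁻¹) : GL (Fin 2) ℝ) : Matrix (Fin 2) (Fin 2) ℝ) 1 0 = 0
    exact h0
  obtain ⟨x, hx | hx⟩ := eq_upperRightHom_or_neg_of_upperTriangular hΓa_le hΓa_d hinf hmem h0'
  · have hxP : x ∈ Γa.strictPeriods := by
      rw [Subgroup.mem_strictPeriods_iff, ← hx]; exact hmem
    rw [hper, AddSubgroup.mem_zmultiples_iff] at hxP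
    obtain ⟨k, rfl⟩ := hxP
    refine ⟨k, Or.inl ?_⟩
    have h1 : Matrix.SpecialLinearGroup.toGL (ω' * ω⁻¹) =
        Matrix.SpecialLinearGroup.toGL (translSL (k : ℝ)) := by
      rw [hx, toGL_translSL, zsmul_eq_mul, mul_one]
    have := Matrix.SpecialLinearGroup.toGL_injective h1
    rw [← this, inv_mul_cancel_right]
  · -- `ω'ω⁻¹ = -T_x`, and `-1 ∈ Γa`, so `T_x ∈ Γa` and `x ∈ ℤ`
    have hTx : Matrix.GeneralLinearGroup.upperRightHom x ∈ Γa := by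
      have h1 : Matrix.GeneralLinearGroup.upperRightHom x =
          (-1 : GL (Fin 2) ℝ) * (Matrix.SpecialLinearGroup.toGL (ω' * ω⁻¹) : GL (Fin 2) ℝ) := by
        rw [hx]; simp
      rw [h1]; exact Γa.mul_mem hΓa_neg hmem
    have hxP : x ∈ Γa.strictPeriods := Subgroup.mem_strictPeriods_iff.mpr hTx
    rw [hper, AddSubgroup.mem_zmultiples_iff] at hxP
    obtain ⟨k, rfl⟩ := hxP
    refine ⟨k, Or.inr ?_⟩
    have h1 : Matrix.SpecialLinearGroup.toGL (ω' * ω⁻¹) =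
        Matrix.SpecialLinearGroup.toGL (-translSL (k : ℝ)) := by
      rw [hx, toGL_neg, toGL_translSL, zsmul_eq_mul, mul_one]
    have h2 := Matrix.SpecialLinearGroup.toGL_injective h1
    rw [← neg_mul, ← h2, inv_mul_cancel_right]

/-- **The summand is independent of the lift**: for a `1`-periodic `p : ℍ → ℂ` and two elements of
`σ_𝔞⁻¹ Γ σ_𝔟` with the same bottom row, `p(ω' w) = p(ω w)`. [cite: Iwaniec2002, §3.1 (3.1) ("`p`
must be invariant with respect to this subgroup"), PDF p. 40] -/
theorem gen_smul_eq_of_row_eq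
    (hΓ : Γ ≤ (Matrix.SpecialLinearGroup.toGL : SL(2, ℝ) →* GL (Fin 2) ℝ).range)
    (hd : IsDiscreteSubgroup Γ) (hneg : (-1 : GL (Fin 2) ℝ) ∈ Γ) {σa σb : SL(2, ℝ)}
    (hper : (ConjAct.toConjAct (Matrix.SpecialLinearGroup.toGL σa : GL (Fin 2) ℝ)⁻¹ • Γ).strictPeriods =
      AddSubgroup.zmultiples (1 : ℝ))
    {p : ℍ → ℂ} (hp : ∀ w : ℍ, p ((1 : ℝ) +ᵥ w) = p w)
    {ω ω' : SL(2, ℝ)} (hω : ω ∈ cuspPairSet Γ σa σb) (hω' : ω' ∈ cuspPairSet Γ σa σb)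
    (hrow : (ω' : Matrix (Fin 2) (Fin 2) ℝ) 1 = (ω : Matrix (Fin 2) (Fin 2) ℝ) 1) (w : ℍ) :
    p (ω' • w) = p (ω • w) := by
  have hnat : ∀ (n : ℕ) (v : ℍ), p ((n : ℝ) +ᵥ v) = p v := by
    intro n
    induction n with
    | zero => intro v; simp
    | succ n ih =>
        intro v
        rw [show ((n + 1 : ℕ) : ℝ) +ᵥ v = (1 : ℝ) +ᵥ ((n : ℝ) +ᵥ v) by
          rw [vadd_vadd]; congr 1; push_cast; ring, hp, ih]
  have hpk : ∀ (k : ℤ) (v : ℍ), p ((k : ℝ) +ᵥ v) = p v := by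
    intro k v
    obtain ⟨n, rfl | rfl⟩ := k.eq_nat_or_neg
    · exact_mod_cast hnat n v
    · have h := hnat n ((((-n : ℤ)) : ℝ) +ᵥ v)
      rw [vadd_vadd, show (n : ℝ) + (((-n : ℤ)) : ℝ) = 0 by push_cast; ring, zero_vadd] at h
      exact h.symm
  obtain ⟨k, h | h⟩ := exists_eq_pm_translSL_mul hΓ hd hneg hper hω hω' hrow
  · rw [h, translSL_mul_smul, hpk]
  · rw [h, neg_sl_smul, translSL_mul_smul, hpk]

/-- The bottom row of a product in `SL₂(ℝ)`: `row(ω g) = row(ω) · g`. [folklore] -/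
theorem sl_row_mul (ω g : SL(2, ℝ)) :
    ((ω * g : SL(2, ℝ)) : Matrix (Fin 2) (Fin 2) ℝ) 1 =
      Matrix.vecMul ((ω : Matrix (Fin 2) (Fin 2) ℝ) 1) (g : Matrix (Fin 2) (Fin 2) ℝ) := by
  ext j
  simp [Matrix.mul_apply, Matrix.vecMul, dotProduct, Fin.sum_univ_two]

/-- Right multiplication by `σ_𝔞⁻¹σ_𝔟` maps `σ_𝔞⁻¹Γσ_𝔞` to `σ_𝔞⁻¹Γσ_𝔟`. [folklore] -/
theorem mul_mem_cuspPairSet_iff {σa σb ω : SL(2, ℝ)} :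
    ω * (σa⁻¹ * σb) ∈ cuspPairSet Γ σa σb ↔ ω ∈ cuspPairSet Γ σa σa := by
  rw [mem_cuspPairSet_iff, mem_cuspPairSet_iff]
  have : σa * (ω * (σa⁻¹ * σb)) * σb⁻¹ = σa * ω * σa⁻¹ := by group
  rw [this]

/-- More generally right multiplication by `δ ∈ σ_𝔟⁻¹Γσ_𝔠` maps `σ_𝔞⁻¹Γσ_𝔟` to `σ_𝔞⁻¹Γσ_𝔠`. [folklore] -/
theorem mul_mem_cuspPairSet {σa σb σc ω δ : SL(2, ℝ)} (hω : ω ∈ cuspPairSet Γ σa σb)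
    (hδ : δ ∈ cuspPairSet Γ σb σc) : ω * δ ∈ cuspPairSet Γ σa σc := by
  rw [mem_cuspPairSet_iff] at hω hδ ⊢
  have : σa * (ω * δ) * σc⁻¹ = (σa * ω * σb⁻¹) * (σb * δ * σc⁻¹) := by group
  rw [this, map_mul]
  exact Γ.mul_mem hω hδ

/-- **The rows of the conjugated group are the rows of `σ_𝔞⁻¹Γσ_𝔞`** (for `Γ ≤ SL₂(ℝ)`). [folklore] -/
theorem rows_conj_eq_pairRows
    (hΓ : Γ ≤ (Matrix.SpecialLinearGroup.toGL : SL(2, ℝ) →* GL (Fin 2) ℝ).range) (σa : SL(2, ℝ)) :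
    rows (ConjAct.toConjAct (Matrix.SpecialLinearGroup.toGL σa : GL (Fin 2) ℝ)⁻¹ • Γ) = pairRows Γ σa σa := by
  ext r
  rw [mem_rows_iff, pairRows, Set.mem_image]
  constructor
  · rintro ⟨γ, hγ, rfl⟩
    obtain ⟨ω, hω, rfl⟩ := (mem_conj_iff_exists hΓ).mp hγ
    exact ⟨ω, hω, rfl⟩
  · rintro ⟨ω, hω, rfl⟩
    exact ⟨Matrix.SpecialLinearGroup.toGL ω, toGL_mem_conj_iff_mem_cuspPairSet.mpr hω, rfl⟩

/-- `↑g * ↑g⁻¹ = 1` for the coerced matrices of `SL₂`. [folklore] -/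
theorem sl_coe_mul_coe_inv (g : SL(2, ℝ)) :
    (g : Matrix (Fin 2) (Fin 2) ℝ) * ((g⁻¹ : SL(2, ℝ)) : Matrix (Fin 2) (Fin 2) ℝ) = 1 := by
  rw [← Matrix.SpecialLinearGroup.coe_mul, mul_inv_cancel, Matrix.SpecialLinearGroup.coe_one]

/-- `↑g⁻¹ * ↑g = 1` for the coerced matrices of `SL₂`. [folklore] -/
theorem sl_coe_inv_mul_coe (g : SL(2, ℝ)) :
    ((g⁻¹ : SL(2, ℝ)) : Matrix (Fin 2) (Fin 2) ℝ) * (g : Matrix (Fin 2) (Fin 2) ℝ) = 1 := by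
  rw [← Matrix.SpecialLinearGroup.coe_mul, inv_mul_cancel, Matrix.SpecialLinearGroup.coe_one]

/-- Rows transported by right multiplication: `r ∈ pairRows σ_𝔞 σ_𝔟`, `δ ∈ σ_𝔟⁻¹Γσ_𝔠` ⇒
`r δ ∈ pairRows σ_𝔞 σ_𝔠`. [folklore] -/
theorem vecMul_mem_pairRows {σa σb σc : SL(2, ℝ)} {r : Fin 2 → ℝ} (hr : r ∈ pairRows Γ σa σb)
    {δ : SL(2, ℝ)} (hδ : δ ∈ cuspPairSet Γ σb σc) :
    Matrix.vecMul r (δ : Matrix (Fin 2) (Fin 2) ℝ) ∈ pairRows Γ σa σc := by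
  obtain ⟨ω, hω, rfl⟩ := hr
  exact ⟨ω * δ, mul_mem_cuspPairSet hω hδ, sl_row_mul ω δ⟩

/-- `σ_𝔞⁻¹σ_𝔟 ∈ σ_𝔞⁻¹Γσ_𝔟` (the image of `1 ∈ Γ`). [folklore] -/
theorem inv_mul_mem_cuspPairSet (σa σb : SL(2, ℝ)) : σa⁻¹ * σb ∈ cuspPairSet Γ σa σb := by
  rw [mem_cuspPairSet_iff]
  have : σa * (σa⁻¹ * σb) * σb⁻¹ = 1 := by group
  rw [this, map_one]; exact Γ.one_mem

/-- Right multiplication by `g = σ_𝔞⁻¹σ_𝔟` on rows: `pairRows σ_𝔞 σ_𝔞 ≃ pairRows σ_𝔞 σ_𝔟`. [folklore] -/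
def pairRowsEquiv (σa σb : SL(2, ℝ)) : pairRows Γ σa σa ≃ pairRows Γ σa σb where
  toFun r := ⟨Matrix.vecMul r.1 ((σa⁻¹ * σb : SL(2, ℝ)) : Matrix (Fin 2) (Fin 2) ℝ),
    vecMul_mem_pairRows r.2 (inv_mul_mem_cuspPairSet σa σb)⟩
  invFun r := ⟨Matrix.vecMul r.1 (((σa⁻¹ * σb)⁻¹ : SL(2, ℝ)) : Matrix (Fin 2) (Fin 2) ℝ),
    vecMul_mem_pairRows r.2 (by
      have := inv_mem_cuspPairSet_iff.mpr (inv_mul_mem_cuspPairSet (Γ := Γ) σa σb)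
      exact this)⟩
  left_inv r := by
    ext1
    simp only [Matrix.vecMul_vecMul, sl_coe_mul_coe_inv, Matrix.vecMul_one]
  right_inv r := by
    ext1
    simp only [Matrix.vecMul_vecMul, sl_coe_inv_mul_coe, Matrix.vecMul_one]

/-- The row of `pairRowsEquiv r` is `r · (σ_𝔞⁻¹σ_𝔟)`. [folklore] -/
theorem pairRowsEquiv_apply (σa σb : SL(2, ℝ)) (r : pairRows Γ σa σa) :
    ((pairRowsEquiv σa σb r : pairRows Γ σa σb) : Fin 2 → ℝ) =
      Matrix.vecMul r.1 ((σa⁻¹ * σb : SL(2, ℝ)) : Matrix (Fin 2) (Fin 2) ℝ) := rfl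

/-- Heights transported along the equivalence: `rowIm (r g) w = rowIm r (g w)`. [folklore] -/
theorem rowIm_pairRowsEquiv (σa σb : SL(2, ℝ)) (r : pairRows Γ σa σa) (w : ℍ) :
    rowIm (pairRowsEquiv σa σb r : pairRows Γ σa σb).1 w = rowIm r.1 ((σa⁻¹ * σb) • w) := by
  rw [pairRowsEquiv_apply, ← toGL_smul_eq]
  exact rowIm_vecMul ⟨σa⁻¹ * σb, rfl⟩ r.1 w

end PairRows

/-! ## 2. The Poincaré series of a cusp pair -/

section Poincare

open scoped Pointwise

variable (Γ) in
/-- **The Poincaré series `E_𝔞(σ_𝔟 w | p)` in the frame of the cusp `𝔟`** (Iwaniec (3.1) at `σ_𝔟 w`,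
through the double cosets of §2.4):
`E_𝔞(σ_𝔟 w | p) = Σ_{τ ∈ B \ σ_𝔞⁻¹Γσ_𝔟} p(τ w) = ½ Σ_{rows r of σ_𝔞⁻¹Γσ_𝔟} p(ω_r w)`,
`ω_r` any element with bottom row `r` (the sum does not depend on the choices for `1`-periodic `p`,
`gen_smul_eq_of_row_eq`; the factor `½` pairs the rows `± r` when `-1 ∈ Γ`). A `tsum`: it is the
genuine series when `Σ_r |p(ω_r w)| < ∞` (`summable_norm_poincarePair`).
[cite: Iwaniec2002, §3.1 (3.1) & §3.4 (first display), PDF pp. 40, 45] -/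
def poincarePair (σa σb : SL(2, ℝ)) (p : ℍ → ℂ) (w : ℍ) : ℂ :=
  (1 / 2) * ∑' r : pairRows Γ σa σb, p (rowLift Γ σa σb r.1 • w)

variable (Γ) in
/-- **The Poincaré series `E_𝔞(z | p) = Σ_{γ ∈ Γ_𝔞 \ Γ} p(σ_𝔞⁻¹ γ z)`** of the cusp `𝔞 = σ_𝔞 ∞`
(Iwaniec (3.1)), as a function on `ℍ`: `E_𝔞(z | p) = E_𝔞(σ_𝔞 (σ_𝔞⁻¹ z) | p)`.
[cite: Iwaniec2002, §3.1 (3.1), PDF p. 40] -/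
def poincare (σa : SL(2, ℝ)) (p : ℍ → ℂ) (z : ℍ) : ℂ :=
  poincarePair Γ σa σa p (σa⁻¹ • z)

/-- **Summability of `Σ_r rowIm(r, w)^σ` over the rows of `σ_𝔞⁻¹Γσ_𝔟`** (`σ > 1`), for
`Γ ≤ SL₂(ℝ)` discrete with `σ_𝔞⁻¹Γσ_𝔞 ∋ T_1` (Lemma 2.10 through `summable_rowIm_rpow`, transported
along `r ↦ r σ_𝔞⁻¹σ_𝔟`). [cite: Iwaniec2002, Lemma 2.10 & §3.1–3.2, PDF pp. 38–43] -/
theorem summable_rowIm_rpow_pairRows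
    (hΓ : Γ ≤ (Matrix.SpecialLinearGroup.toGL : SL(2, ℝ) →* GL (Fin 2) ℝ).range)
    (hd : IsDiscreteSubgroup Γ) {σa σb : SL(2, ℝ)} (hTa : translSL 1 ∈ cuspPairSet Γ σa σa)
    {σ : ℝ} (hσ : 1 < σ) (w : ℍ) :
    Summable fun r : pairRows Γ σa σb => rowIm r.1 w ^ σ := by
  set Γa : Subgroup (GL (Fin 2) ℝ) :=
    ConjAct.toConjAct (Matrix.SpecialLinearGroup.toGL σa : GL (Fin 2) ℝ)⁻¹ • Γ with hΓa
  have hΓa_le : Γa ≤ (Matrix.SpecialLinearGroup.toGL : SL(2, ℝ) →* GL (Fin 2) ℝ).range := by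
    have h := conj_le_range hΓ σa⁻¹
    rwa [map_inv] at h
  have hΓa_d : IsDiscreteSubgroup Γa := hd.conj _
  have hT1 : Matrix.GeneralLinearGroup.upperRightHom (1 : ℝ) ∈ Γa := by
    rw [← toGL_translSL]; exact toGL_mem_conj_iff_mem_cuspPairSet.mpr hTa
  have h1 : Summable fun r : rows Γa => rowIm r.1 ((σa⁻¹ * σb) • w) ^ σ :=
    summable_rowIm_rpow hΓa_le hΓa_d hT1 _ hσ
  have h2 : Summable fun r : pairRows Γ σa σa => rowIm r.1 ((σa⁻¹ * σb) • w) ^ σ := by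
    rw [rows_conj_eq_pairRows hΓ σa] at h1
    exact h1
  rw [← (pairRowsEquiv σa σb).summable_iff]
  refine h2.congr fun r => ?_
  simp only [Function.comp_apply]
  rw [rowIm_pairRowsEquiv]

/-- **Absolute convergence** (Iwaniec: "satisfies a suitable growth condition", (3.9)): if
`|p(v)| ≤ C (Im v)^σ` with `σ > 1` then `Σ_r |p(ω_r w)| < ∞`.
[cite: Iwaniec2002, §3.2 (3.9) & Lemma 2.10, PDF pp. 38, 42] -/
theorem summable_norm_poincarePair
    (hΓ : Γ ≤ (Matrix.SpecialLinearGroup.toGL : SL(2, ℝ) →* GL (Fin 2) ℝ).range)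
    (hd : IsDiscreteSubgroup Γ) {σa σb : SL(2, ℝ)} (hTa : translSL 1 ∈ cuspPairSet Γ σa σa)
    {p : ℍ → ℂ} {C σ : ℝ} (hσ : 1 < σ) (hp : ∀ v : ℍ, ‖p v‖ ≤ C * v.im ^ σ) (w : ℍ) :
    Summable fun r : pairRows Γ σa σb => ‖p (rowLift Γ σa σb r.1 • w)‖ := by
  refine Summable.of_nonneg_of_le (fun r => norm_nonneg _) (fun r => ?_)
    ((summable_rowIm_rpow_pairRows hΓ hd hTa hσ w).mul_left C)
  have hmem := rowLift_mem_and_row r.2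
  calc ‖p (rowLift Γ σa σb r.1 • w)‖ ≤ C * (rowLift Γ σa σb r.1 • w).im ^ σ := hp _
    _ = C * rowIm r.1 w ^ σ := by rw [im_sl_smul_eq_rowIm, hmem.2]

/-- The uniform partial-sum version: `Σ_{r ∈ T} |p(ω_r w)| ≤ C Σ_{r ∈ T} rowIm(r, w)^σ`. [folklore] -/
theorem norm_gen_rowLift_le {σa σb : SL(2, ℝ)} {p : ℍ → ℂ} {C σ : ℝ}
    (hp : ∀ v : ℍ, ‖p v‖ ≤ C * v.im ^ σ) (r : pairRows Γ σa σb) (w : ℍ) :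
    ‖p (rowLift Γ σa σb r.1 • w)‖ ≤ C * rowIm r.1 w ^ σ := by
  have hmem := rowLift_mem_and_row r.2
  calc ‖p (rowLift Γ σa σb r.1 • w)‖ ≤ C * (rowLift Γ σa σb r.1 • w).im ^ σ := hp _
    _ = C * rowIm r.1 w ^ σ := by rw [im_sl_smul_eq_rowIm, hmem.2]

/-- **Reindexing by the group at `𝔟`**: for `δ ∈ σ_𝔟⁻¹Γσ_𝔟` the map `r ↦ r δ` permutes the rows of
`σ_𝔞⁻¹Γσ_𝔟`. [folklore] -/
def pairRowsMulEquiv {σa σb δ : SL(2, ℝ)} (hδ : δ ∈ cuspPairSet Γ σb σb) :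
    pairRows Γ σa σb ≃ pairRows Γ σa σb where
  toFun r := ⟨Matrix.vecMul r.1 (δ : Matrix (Fin 2) (Fin 2) ℝ), vecMul_mem_pairRows r.2 hδ⟩
  invFun r := ⟨Matrix.vecMul r.1 ((δ⁻¹ : SL(2, ℝ)) : Matrix (Fin 2) (Fin 2) ℝ),
    vecMul_mem_pairRows r.2 (inv_mem_cuspPairSet_iff.mpr hδ)⟩
  left_inv r := by
    ext1
    simp only [Matrix.vecMul_vecMul, sl_coe_mul_coe_inv, Matrix.vecMul_one]
  right_inv r := by
    ext1
    simp only [Matrix.vecMul_vecMul, sl_coe_inv_mul_coe, Matrix.vecMul_one]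

/-- **Invariance of `E_𝔞(σ_𝔟 · | p)` under `σ_𝔟⁻¹Γσ_𝔟`** (= automorphy of `E_𝔞(· | p)` read in the
frame of `𝔟`): `E_𝔞(σ_𝔟 δ w | p) = E_𝔞(σ_𝔟 w | p)` for `δ ∈ σ_𝔟⁻¹Γσ_𝔟`, for every `1`-periodic `p`
(no convergence needed: reindexing `r ↦ r δ`). [cite: Iwaniec2002, §3.1 (3.1) ("`∈ 𝒜(Γ\ℍ)`"), PDF p. 40] -/
theorem poincarePair_smul
    (hΓ : Γ ≤ (Matrix.SpecialLinearGroup.toGL : SL(2, ℝ) →* GL (Fin 2) ℝ).range)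
    (hd : IsDiscreteSubgroup Γ) (hneg : (-1 : GL (Fin 2) ℝ) ∈ Γ) {σa σb : SL(2, ℝ)}
    (hper : (ConjAct.toConjAct (Matrix.SpecialLinearGroup.toGL σa : GL (Fin 2) ℝ)⁻¹ • Γ).strictPeriods =
      AddSubgroup.zmultiples (1 : ℝ))
    {p : ℍ → ℂ} (hp : ∀ w : ℍ, p ((1 : ℝ) +ᵥ w) = p w)
    {δ : SL(2, ℝ)} (hδ : δ ∈ cuspPairSet Γ σb σb) (w : ℍ) :
    poincarePair Γ σa σb p (δ • w) = poincarePair Γ σa σb p w := by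
  unfold poincarePair
  congr 1
  have e : ∀ r : pairRows Γ σa σb,
      p (rowLift Γ σa σb r.1 • δ • w) = p (rowLift Γ σa σb (pairRowsMulEquiv hδ r).1 • w) := by
    intro r
    have h1 := rowLift_mem_and_row r.2
    have h2 := rowLift_mem_and_row (pairRowsMulEquiv hδ r).2
    -- both `ω_r δ` and `ω_{rδ}` lie in `σ_𝔞⁻¹Γσ_𝔟` with the row `r δ`
    have hrow : ((rowLift Γ σa σb r.1 * δ : SL(2, ℝ)) : Matrix (Fin 2) (Fin 2) ℝ) 1 =
        (rowLift Γ σa σb (pairRowsMulEquiv hδ r).1 : Matrix (Fin 2) (Fin 2) ℝ) 1 := by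
      rw [sl_row_mul, h1.2, h2.2]; rfl
    rw [← mul_smul]
    exact gen_smul_eq_of_row_eq hΓ hd hneg hper hp h2.1 (mul_mem_cuspPairSet h1.1 hδ) hrow w
  simp_rw [e]
  exact (pairRowsMulEquiv hδ).tsum_eq (fun r : pairRows Γ σa σb => p (rowLift Γ σa σb r.1 • w))

/-- **`E_𝔞(σ_𝔟 w | p)` through the series of the pair `(𝔞, 𝔞)`**:
`E_𝔞(σ_𝔟 w | p) = poincarePair σ_𝔞 σ_𝔞 p (σ_𝔞⁻¹σ_𝔟 w)`, i.e. `poincare σ_𝔞 p (σ_𝔟 w) = poincarePair σ_𝔞 σ_𝔟 p w`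
(reindexing `r ↦ r σ_𝔞⁻¹σ_𝔟`). [cite: Iwaniec2002, §3.4 (first display), PDF p. 45] -/
theorem poincare_sigma_smul
    (hΓ : Γ ≤ (Matrix.SpecialLinearGroup.toGL : SL(2, ℝ) →* GL (Fin 2) ℝ).range)
    (hd : IsDiscreteSubgroup Γ) (hneg : (-1 : GL (Fin 2) ℝ) ∈ Γ) {σa σb : SL(2, ℝ)}
    (hper : (ConjAct.toConjAct (Matrix.SpecialLinearGroup.toGL σa : GL (Fin 2) ℝ)⁻¹ • Γ).strictPeriods =
      AddSubgroup.zmultiples (1 : ℝ))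
    {p : ℍ → ℂ} (hp : ∀ w : ℍ, p ((1 : ℝ) +ᵥ w) = p w) (w : ℍ) :
    poincare Γ σa p (σb • w) = poincarePair Γ σa σb p w := by
  unfold poincare poincarePair
  rw [← mul_smul]
  congr 1
  rw [← (pairRowsEquiv σa σb).tsum_eq (fun r : pairRows Γ σa σb => p (rowLift Γ σa σb r.1 • w))]
  refine tsum_congr fun r => ?_
  have h1 := rowLift_mem_and_row r.2
  have h2 := rowLift_mem_and_row (pairRowsEquiv σa σb r).2
  have hrow : ((rowLift Γ σa σa r.1 * (σa⁻¹ * σb) : SL(2, ℝ)) : Matrix (Fin 2) (Fin 2) ℝ) 1 =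
      (rowLift Γ σa σb (pairRowsEquiv σa σb r).1 : Matrix (Fin 2) (Fin 2) ℝ) 1 := by
    rw [sl_row_mul, h1.2, h2.2]; rfl
  have := gen_smul_eq_of_row_eq hΓ hd hneg hper hp h2.1 (mul_mem_cuspPairSet_iff.mpr h1.1) hrow w
  rw [mul_smul] at this
  exact this

/-- **Automorphy of `E_𝔞(· | p)`**: `E_𝔞(γ z | p) = E_𝔞(z | p)` for `γ ∈ Γ`, every `1`-periodic `p`.
[cite: Iwaniec2002, §3.1 (3.1), PDF p. 40] -/
theorem poincare_smul
    (hΓ : Γ ≤ (Matrix.SpecialLinearGroup.toGL : SL(2, ℝ) →* GL (Fin 2) ℝ).range)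
    (hd : IsDiscreteSubgroup Γ) (hneg : (-1 : GL (Fin 2) ℝ) ∈ Γ) {σa : SL(2, ℝ)}
    (hper : (ConjAct.toConjAct (Matrix.SpecialLinearGroup.toGL σa : GL (Fin 2) ℝ)⁻¹ • Γ).strictPeriods =
      AddSubgroup.zmultiples (1 : ℝ))
    {p : ℍ → ℂ} (hp : ∀ w : ℍ, p ((1 : ℝ) +ᵥ w) = p w)
    {γ : SL(2, ℝ)} (hγ : (Matrix.SpecialLinearGroup.toGL γ : GL (Fin 2) ℝ) ∈ Γ) (z : ℍ) :
    poincare Γ σa p (γ • z) = poincare Γ σa p z := by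
  have hδ : σa⁻¹ * γ * σa ∈ cuspPairSet Γ σa σa := conj_mem_cuspPairSet hγ
  have e : σa⁻¹ • γ • z = (σa⁻¹ * γ * σa) • (σa⁻¹ • z) := by
    rw [← mul_smul, ← mul_smul]; congr 1; group
  unfold poincare
  rw [e, poincarePair_smul hΓ hd hneg hper hp hδ]

/-- `E_𝔞(· | p)` is `Γ`-automorphic (for `Γ ≤ SL₂(ℝ)`). [cite: Iwaniec2002, §3.1 (3.1), PDF p. 40] -/
theorem isAutomorphic_poincare
    (hΓ : Γ ≤ (Matrix.SpecialLinearGroup.toGL : SL(2, ℝ) →* GL (Fin 2) ℝ).range)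
    (hd : IsDiscreteSubgroup Γ) (hneg : (-1 : GL (Fin 2) ℝ) ∈ Γ) {σa : SL(2, ℝ)}
    (hper : (ConjAct.toConjAct (Matrix.SpecialLinearGroup.toGL σa : GL (Fin 2) ℝ)⁻¹ • Γ).strictPeriods =
      AddSubgroup.zmultiples (1 : ℝ))
    {p : ℍ → ℂ} (hp : ∀ w : ℍ, p ((1 : ℝ) +ᵥ w) = p w) :
    IsAutomorphic Γ (poincare Γ σa p) := by
  intro γ hγ z
  obtain ⟨g, rfl⟩ := hΓ hγ
  rw [toGL_smul_eq]
  exact poincare_smul hΓ hd hneg hper hp hγ z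

/-- **The size of the Poincaré series**: `|E_𝔞(σ_𝔟 w | p)| ≤ (C/2) Σ_r rowIm(r, w)^σ`. [folklore] -/
theorem norm_poincarePair_le
    (hΓ : Γ ≤ (Matrix.SpecialLinearGroup.toGL : SL(2, ℝ) →* GL (Fin 2) ℝ).range)
    (hd : IsDiscreteSubgroup Γ) {σa σb : SL(2, ℝ)} (hTa : translSL 1 ∈ cuspPairSet Γ σa σa)
    {p : ℍ → ℂ} {C σ : ℝ} (hσ : 1 < σ) (hp : ∀ v : ℍ, ‖p v‖ ≤ C * v.im ^ σ) (w : ℍ) :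
    ‖poincarePair Γ σa σb p w‖ ≤ (1 / 2) * (C * ∑' r : pairRows Γ σa σb, rowIm r.1 w ^ σ) := by
  have hs := summable_norm_poincarePair hΓ hd hTa hσ hp w (σb := σb)
  have hS := summable_rowIm_rpow_pairRows hΓ hd hTa hσ w (σb := σb)
  rw [poincarePair, norm_mul, show ‖(1 / 2 : ℂ)‖ = 1 / 2 by norm_num, ← tsum_mul_left]
  gcongr
  refine (norm_tsum_le_tsum_norm hs).trans ?_
  exact hs.tsum_le_tsum (fun r => norm_gen_rowLift_le hp r w) (hS.mul_left C)

end Poincare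



/-! ## 3. Tools for the Fourier modes at the cusp `𝔟` -/

section ModeTools

open scoped Pointwise
open _root_.MeasureTheory Set Filter

/-- **Harnack-type comparison of heights for `SL₂(ℝ)`**: `Im(ω w) ≤ Im(ω z) e^{ρ(w, z)}`. [folklore] -/
theorem im_sl_smul_le_mul_exp_dist (ω : SL(2, ℝ)) (w z : ℍ) :
    (ω • w).im ≤ (ω • z).im * Real.exp (dist w z) := by
  have h := UpperHalfPlane.im_le_im_mul_exp_dist (ω • w) (ω • z)
  rwa [dist_smul] at h

/-- Heights of pair rows on a set of bounded diameter: `rowIm(r, w) ≤ rowIm(r, z) e^{ρ(w,z)}` for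
`r ∈ pairRows`. [folklore] -/
theorem rowIm_le_mul_exp_dist_of_mem_pairRows {σa σb : SL(2, ℝ)} {r : Fin 2 → ℝ}
    (hr : r ∈ pairRows Γ σa σb) (w z : ℍ) : rowIm r w ≤ rowIm r z * Real.exp (dist w z) := by
  obtain ⟨ω, -, rfl⟩ := hr
  rw [← im_sl_smul_eq_rowIm, ← im_sl_smul_eq_rowIm]
  exact im_sl_smul_le_mul_exp_dist ω w z

/-- Rows of a negated matrix. [folklore] -/
theorem matrix_neg_row {m n : Type*} (M : Matrix m n ℝ) (i : m) : (-M) i = -(M i) := rfl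

/-- `σ_𝔞⁻¹Γσ_𝔟` is stable under `ω ↦ -ω` when `-1 ∈ Γ`; rows: `r ∈ pairRows ↔ -r ∈ pairRows`. [folklore] -/
theorem neg_mem_pairRows_iff (hneg : (-1 : GL (Fin 2) ℝ) ∈ Γ) {σa σb : SL(2, ℝ)} {r : Fin 2 → ℝ} :
    -r ∈ pairRows Γ σa σb ↔ r ∈ pairRows Γ σa σb := by
  constructor
  · rintro ⟨ω, hω, hr⟩
    refine ⟨-ω, (neg_mem_cuspPairSet_iff hneg).mpr hω, ?_⟩
    change ((ω : Matrix (Fin 2) (Fin 2) ℝ) 1) = -r at hr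
    show ((-ω : SL(2, ℝ)) : Matrix (Fin 2) (Fin 2) ℝ) 1 = r
    rw [Matrix.SpecialLinearGroup.coe_neg, matrix_neg_row, hr, neg_neg]
  · rintro ⟨ω, hω, hr⟩
    refine ⟨-ω, (neg_mem_cuspPairSet_iff hneg).mpr hω, ?_⟩
    change ((ω : Matrix (Fin 2) (Fin 2) ℝ) 1) = r at hr
    show ((-ω : SL(2, ℝ)) : Matrix (Fin 2) (Fin 2) ℝ) 1 = -r
    rw [Matrix.SpecialLinearGroup.coe_neg, matrix_neg_row, hr]

/-- **The summand at the row `-r` equals the summand at `r`** (`-ω_r` has the row `-r` and acts as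
`ω_r`). [folklore] -/
theorem gen_rowLift_neg
    (hΓ : Γ ≤ (Matrix.SpecialLinearGroup.toGL : SL(2, ℝ) →* GL (Fin 2) ℝ).range)
    (hd : IsDiscreteSubgroup Γ) (hneg : (-1 : GL (Fin 2) ℝ) ∈ Γ) {σa σb : SL(2, ℝ)}
    (hper : (ConjAct.toConjAct (Matrix.SpecialLinearGroup.toGL σa : GL (Fin 2) ℝ)⁻¹ • Γ).strictPeriods =
      AddSubgroup.zmultiples (1 : ℝ))
    {p : ℍ → ℂ} (hp : ∀ w : ℍ, p ((1 : ℝ) +ᵥ w) = p w)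
    {r : Fin 2 → ℝ} (hr : r ∈ pairRows Γ σa σb) (w : ℍ) :
    p (rowLift Γ σa σb (-r) • w) = p (rowLift Γ σa σb r • w) := by
  have h1 := rowLift_mem_and_row hr
  have h2 := rowLift_mem_and_row ((neg_mem_pairRows_iff hneg).mpr hr)
  have hrow : ((-rowLift Γ σa σb r : SL(2, ℝ)) : Matrix (Fin 2) (Fin 2) ℝ) 1 =
      (rowLift Γ σa σb (-r) : Matrix (Fin 2) (Fin 2) ℝ) 1 := by
    rw [Matrix.SpecialLinearGroup.coe_neg, matrix_neg_row, h1.2, h2.2]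
  have := gen_smul_eq_of_row_eq hΓ hd hneg hper hp h2.1 ((neg_mem_cuspPairSet_iff hneg).mpr h1.1) hrow w
  rw [neg_sl_smul] at this
  exact this.symm

/-- **The summand at the row `(c, d + kc)` is the summand at `(c, d)` translated by `k`**:
`p(ω_{(c,d+kc)} w) = p(ω_{(c,d)} (w + k))` (`ω_{(c,d)} T_k` has the row `(c, d + kc)`).
[cite: Iwaniec2002, §2.4 (2.20) & §3.4, PDF pp. 35, 45] -/
theorem gen_rowLift_translate
    (hΓ : Γ ≤ (Matrix.SpecialLinearGroup.toGL : SL(2, ℝ) →* GL (Fin 2) ℝ).range)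
    (hd : IsDiscreteSubgroup Γ) (hneg : (-1 : GL (Fin 2) ℝ) ∈ Γ) {σa σb : SL(2, ℝ)}
    (hper : (ConjAct.toConjAct (Matrix.SpecialLinearGroup.toGL σa : GL (Fin 2) ℝ)⁻¹ • Γ).strictPeriods =
      AddSubgroup.zmultiples (1 : ℝ))
    (hTb : translSL 1 ∈ cuspPairSet Γ σb σb)
    {p : ℍ → ℂ} (hp : ∀ w : ℍ, p ((1 : ℝ) +ᵥ w) = p w)
    {r : Fin 2 → ℝ} (hr : r ∈ pairRows Γ σa σb) (k : ℤ) (w : ℍ) :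
    p (rowLift Γ σa σb (![r 0, r 1 + k * r 0]) • w) = p (rowLift Γ σa σb r • ((k : ℝ) +ᵥ w)) := by
  have h1 := rowLift_mem_and_row hr
  have hk : rowLift Γ σa σb r * translSL k ∈ cuspPairSet Γ σa σb := mul_translSL_mem h1.1 hTb k
  have hrow' : ((rowLift Γ σa σb r * translSL k : SL(2, ℝ)) : Matrix (Fin 2) (Fin 2) ℝ) 1 =
      ![r 0, r 1 + k * r 0] := by
    have e := mul_translSL_apply (rowLift Γ σa σb r) k
    have e0 : (rowLift Γ σa σb r) 1 0 = r 0 := congr_fun h1.2 0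
    have e1 : (rowLift Γ σa σb r) 1 1 = r 1 := congr_fun h1.2 1
    ext j
    fin_cases j
    · show (rowLift Γ σa σb r * translSL ↑k) 1 0 = r 0
      rw [e.2.2.1, e0]
    · show (rowLift Γ σa σb r * translSL ↑k) 1 1 = r 1 + k * r 0
      rw [e.2.2.2, e0, e1]; ring
  have hmem : (![r 0, r 1 + k * r 0] : Fin 2 → ℝ) ∈ pairRows Γ σa σb := ⟨_, hk, hrow'⟩
  have h2 := rowLift_mem_and_row hmem
  have hrow : ((rowLift Γ σa σb r * translSL k : SL(2, ℝ)) : Matrix (Fin 2) (Fin 2) ℝ) 1 =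
      (rowLift Γ σa σb (![r 0, r 1 + k * r 0]) : Matrix (Fin 2) (Fin 2) ℝ) 1 := by
    rw [hrow', h2.2]
  have := gen_smul_eq_of_row_eq hΓ hd hneg hper hp h2.1 hk hrow w
  rw [mul_smul, ← toGL_smul_eq (translSL (k : ℝ)), toGL_translSL, upperRightHom_smul] at this
  exact this.symm

/-- **Unfolding the period integral over `ℤ`-translates**: for `F` integrable on `ℝ`,
`Σ_{k ∈ ℤ} ∫₀¹ F(x + k) dx = ∫_ℝ F`. [folklore] -/
theorem hasSum_intervalIntegral_comp_add_int {F : ℝ → ℂ} (hF : Integrable F) :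
    HasSum (fun k : ℤ => ∫ x in (0 : ℝ)..1, F (x + k)) (∫ t : ℝ, F t) := by
  have hU : (⋃ k : ℤ, Ioc ((0 : ℝ) + k) (0 + k + 1)) = univ := iUnion_Ioc_add_intCast (0 : ℝ)
  have hdisj : Pairwise (Function.onFun Disjoint fun k : ℤ => Ioc ((0 : ℝ) + k) (0 + k + 1)) :=
    pairwise_disjoint_Ioc_add_intCast (0 : ℝ)
  have h := hasSum_integral_iUnion (fun k : ℤ => measurableSet_Ioc) hdisj (by rw [hU]; exact hF.integrableOn)
  rw [hU, Measure.restrict_univ] at h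
  refine h.congr_fun fun k => ?_
  simp only [zero_add]
  rw [intervalIntegral.integral_comp_add_right (fun t => F t) (k : ℝ), zero_add, add_comm,
    intervalIntegral.integral_of_le (by linarith : (k : ℝ) ≤ k + 1)]

/-- The `tsum` form of the unfolding. [folklore] -/
theorem tsum_intervalIntegral_comp_add_int {F : ℝ → ℂ} (hF : Integrable F) :
    ∑' k : ℤ, ∫ x in (0 : ℝ)..1, F (x + k) = ∫ t : ℝ, F t :=
  (hasSum_intervalIntegral_comp_add_int hF).tsum_eq

end ModeTools

/-! ## 4. Decomposition of the rows: `c = 0`, `c > 0` reduced modulo `c`, and their translates -/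

section RowDecomposition

open scoped Pointwise
open Set

/-- `σ_𝔞⁻¹Γσ_𝔟` is countable (it injects into `Γ`, a discrete hence countable group). [folklore] -/
theorem countable_cuspPairSet (hd : IsDiscreteSubgroup Γ) (σa σb : SL(2, ℝ)) :
    (cuspPairSet Γ σa σb).Countable := by
  have h : cuspPairSet Γ σa σb =
      (fun ω : SL(2, ℝ) => (Matrix.SpecialLinearGroup.toGL (σa * ω * σb⁻¹) : GL (Fin 2) ℝ)) ⁻¹'
        (Γ : Set (GL (Fin 2) ℝ)) := rfl
  rw [h]
  refine hd.countable.preimage_of_injOn (Set.injOn_of_injective ?_)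
  intro ω ω' hωω'
  have := Matrix.SpecialLinearGroup.toGL_injective hωω'
  simpa using this

/-- Hence the rows of `σ_𝔞⁻¹Γσ_𝔟` are countable. [folklore] -/
theorem countable_pairRows (hd : IsDiscreteSubgroup Γ) (σa σb : SL(2, ℝ)) :
    (pairRows Γ σa σb).Countable :=
  (countable_cuspPairSet hd σa σb).image _

variable (Γ) in
/-- The rows with `c = 0` (present only when `𝔞` and `𝔟` are `Γ`-equivalent). [cite: Iwaniec2002, §2.4 (2.16)–(2.18), PDF p. 34] -/
def zeroRows (σa σb : SL(2, ℝ)) : Set (Fin 2 → ℝ) := {r | r ∈ pairRows Γ σa σb ∧ r 0 = 0}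

variable (Γ) in
/-- The rows with `c > 0`. [cite: Iwaniec2002, §2.4 (2.21) ("`c > 0`"), PDF p. 35] -/
def posRows (σa σb : SL(2, ℝ)) : Set (Fin 2 → ℝ) := {r | r ∈ pairRows Γ σa σb ∧ 0 < r 0}

variable (Γ) in
/-- The rows with `c < 0` (the negatives of `posRows` when `-1 ∈ Γ`). [folklore] -/
def negRows (σa σb : SL(2, ℝ)) : Set (Fin 2 → ℝ) := {r | r ∈ pairRows Γ σa σb ∧ r 0 < 0}

variable (Γ) in
/-- **The reduced rows `(c, d)`, `c > 0`, `0 ≤ d < c`** — the double cosets `B \ σ_𝔞⁻¹Γσ_𝔟 / B`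
with `c > 0` (Theorem 2.7), i.e. the pairs `c ∈ 𝒞_𝔞𝔟`, `d ∈ bottomReps c`.
[cite: Iwaniec2002, Theorem 2.7 & (2.21)–(2.23), PDF pp. 35–36] -/
def redRows (σa σb : SL(2, ℝ)) : Set (Fin 2 → ℝ) :=
  {r | r ∈ pairRows Γ σa σb ∧ 0 < r 0 ∧ r 1 ∈ Ico 0 (r 0)}

/-- The three-way partition of the rows. [folklore] -/
theorem pairRows_eq_union (σa σb : SL(2, ℝ)) :
    pairRows Γ σa σb = zeroRows Γ σa σb ∪ (posRows Γ σa σb ∪ negRows Γ σa σb) := by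
  ext r
  simp only [zeroRows, posRows, negRows, mem_union, mem_setOf_eq]
  constructor
  · intro h
    rcases lt_trichotomy (r 0) 0 with h0 | h0 | h0
    · exact Or.inr (Or.inr ⟨h, h0⟩)
    · exact Or.inl ⟨h, h0⟩
    · exact Or.inr (Or.inl ⟨h, h0⟩)
  · rintro (h | h | h) <;> exact h.1

/-- Disjointness of the partition, I. [folklore] -/
theorem disjoint_zeroRows (σa σb : SL(2, ℝ)) :
    Disjoint (zeroRows Γ σa σb) (posRows Γ σa σb ∪ negRows Γ σa σb) := by
  rw [Set.disjoint_left]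
  rintro r ⟨-, h0⟩ (⟨-, h⟩ | ⟨-, h⟩) <;> linarith

/-- Disjointness of the partition, II. [folklore] -/
theorem disjoint_posRows_negRows (σa σb : SL(2, ℝ)) : Disjoint (posRows Γ σa σb) (negRows Γ σa σb) := by
  rw [Set.disjoint_left]
  rintro r ⟨-, h⟩ ⟨-, h'⟩
  linarith

/-- `r ↦ -r` is a bijection `negRows ≃ posRows` (`-1 ∈ Γ`). [folklore] -/
def negRowsEquiv (hneg : (-1 : GL (Fin 2) ℝ) ∈ Γ) (σa σb : SL(2, ℝ)) : negRows Γ σa σb ≃ posRows Γ σa σb where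
  toFun r := ⟨-r.1, (neg_mem_pairRows_iff hneg).mpr r.2.1, by have := r.2.2; simp only [Pi.neg_apply]; linarith⟩
  invFun r := ⟨-r.1, (neg_mem_pairRows_iff hneg).mpr r.2.1, by have := r.2.2; simp only [Pi.neg_apply]; linarith⟩
  left_inv r := by ext1; simp
  right_inv r := by ext1; simp

/-- A reduced row translated by `k`: `(c, d + kc)` is a row with `c > 0`. [folklore] -/
theorem translate_mem_posRows {σa σb : SL(2, ℝ)} (hTb : translSL 1 ∈ cuspPairSet Γ σb σb)
    {r : Fin 2 → ℝ} (hr : r ∈ pairRows Γ σa σb) (h0 : 0 < r 0) (k : ℤ) :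
    (![r 0, r 1 + k * r 0] : Fin 2 → ℝ) ∈ posRows Γ σa σb := by
  obtain ⟨ω, hω, rfl⟩ := hr
  refine ⟨⟨ω * translSL k, mul_translSL_mem hω hTb k, ?_⟩, by simpa using h0⟩
  have e := mul_translSL_apply ω k
  ext j
  fin_cases j
  · exact e.2.2.1
  · show (ω * translSL ↑k) 1 1 = _
    rw [e.2.2.2]; simp; ring

/-- **The double cosets of modulus `c > 0` and their translates**: `redRows × ℤ ≃ posRows`,
`((c, d), k) ↦ (c, d + kc)` with inverse `(c, d') ↦ ((c, d' - ⌊d'/c⌋c), ⌊d'/c⌋)` (Iwaniec (2.20):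
"`Ω_{d/c}` … determines `d (mod c)` uniquely"). [cite: Iwaniec2002, §2.4 (2.19)–(2.21), PDF p. 35] -/
def redRowsProdEquiv {σa σb : SL(2, ℝ)} (hTb : translSL 1 ∈ cuspPairSet Γ σb σb) :
    redRows Γ σa σb × ℤ ≃ posRows Γ σa σb where
  toFun q := ⟨![q.1.1 0, q.1.1 1 + q.2 * q.1.1 0], translate_mem_posRows hTb q.1.2.1 q.1.2.2.1 q.2⟩
  invFun r := (⟨![r.1 0, r.1 1 + (-⌊r.1 1 / r.1 0⌋ : ℤ) * r.1 0],
      (translate_mem_posRows hTb r.2.1 r.2.2 _).1, by simpa using r.2.2, by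
        have hc : 0 < r.1 0 := r.2.2
        constructor
        · have h1 : (⌊r.1 1 / r.1 0⌋ : ℝ) ≤ r.1 1 / r.1 0 := Int.floor_le _
          have h2 : (⌊r.1 1 / r.1 0⌋ : ℝ) * r.1 0 ≤ r.1 1 := by rwa [le_div_iff₀ hc] at h1
          simp; linarith
        · have h1 : r.1 1 / r.1 0 < (⌊r.1 1 / r.1 0⌋ : ℝ) + 1 := Int.lt_floor_add_one _
          have h2 : r.1 1 < ((⌊r.1 1 / r.1 0⌋ : ℝ) + 1) * r.1 0 := by rwa [div_lt_iff₀ hc] at h1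
          simp; nlinarith⟩, ⌊r.1 1 / r.1 0⌋)
  left_inv q := by
    obtain ⟨⟨r, hr, hc, hd0, hdc⟩, k⟩ := q
    have hk : ⌊(r 1 + k * r 0) / r 0⌋ = k := by
      rw [Int.floor_eq_iff]
      constructor
      · rw [le_div_iff₀ hc]; nlinarith
      · rw [div_lt_iff₀ hc]; nlinarith
    refine Prod.ext ?_ ?_
    · apply Subtype.ext
      show (![(![r 0, r 1 + k * r 0] : Fin 2 → ℝ) 0, (![r 0, r 1 + k * r 0] : Fin 2 → ℝ) 1 +
          ((-⌊(![r 0, r 1 + k * r 0] : Fin 2 → ℝ) 1 / (![r 0, r 1 + k * r 0] : Fin 2 → ℝ) 0⌋ : ℤ) : ℝ) *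
            (![r 0, r 1 + k * r 0] : Fin 2 → ℝ) 0] : Fin 2 → ℝ) = r
      simp only [Matrix.cons_val_zero, Matrix.cons_val_one, hk]
      ext j
      fin_cases j
      · simp
      · simp
    · show ⌊(![r 0, r 1 + k * r 0] : Fin 2 → ℝ) 1 / (![r 0, r 1 + k * r 0] : Fin 2 → ℝ) 0⌋ = k
      simp only [Matrix.cons_val_zero, Matrix.cons_val_one, hk]
  right_inv r := by
    obtain ⟨r, hr, hc⟩ := r
    apply Subtype.ext
    show (![(![r 0, r 1 + ((-⌊r 1 / r 0⌋ : ℤ) : ℝ) * r 0] : Fin 2 → ℝ) 0,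
        (![r 0, r 1 + ((-⌊r 1 / r 0⌋ : ℤ) : ℝ) * r 0] : Fin 2 → ℝ) 1 +
          (⌊r 1 / r 0⌋ : ℝ) * (![r 0, r 1 + ((-⌊r 1 / r 0⌋ : ℤ) : ℝ) * r 0] : Fin 2 → ℝ) 0] : Fin 2 → ℝ) = r
    simp only [Matrix.cons_val_zero, Matrix.cons_val_one]
    ext j
    fin_cases j
    · simp
    · simp

/-- The value of the equivalence (for rewriting). [folklore] -/
theorem redRowsProdEquiv_apply {σa σb : SL(2, ℝ)} (hTb : translSL 1 ∈ cuspPairSet Γ σb σb)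
    (q : redRows Γ σa σb × ℤ) :
    ((redRowsProdEquiv hTb q : posRows Γ σa σb) : Fin 2 → ℝ) = ![q.1.1 0, q.1.1 1 + q.2 * q.1.1 0] := rfl

/-- **Reduced rows and the Kloosterman data**: `(c, d) ∈ redRows ↔ c ∈ 𝒞_𝔞𝔟 ∧ d ∈ bottomReps c`. [folklore] -/
theorem mem_redRows_iff {σa σb : SL(2, ℝ)} {r : Fin 2 → ℝ} :
    r ∈ redRows Γ σa σb ↔ r 0 ∈ kloostermanModuli Γ σa σb ∧ r 1 ∈ bottomReps Γ σa σb (r 0) := by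
  constructor
  · rintro ⟨⟨ω, hω, hr⟩, hc, hd⟩
    refine ⟨⟨hc, ω, hω, congr_fun hr 0⟩, ⟨ω, hω, congr_fun hr 0, congr_fun hr 1⟩, hd⟩
  · rintro ⟨⟨hc, -⟩, ⟨ω, hω, h0, h1⟩, hd⟩
    refine ⟨⟨ω, hω, ?_⟩, hc, hd⟩
    ext j
    fin_cases j
    · exact h0
    · exact h1

end RowDecomposition

/-! ## 5. The Fourier modes of `E_𝔞(σ_𝔟 · | p)` along a horocycle: unfolding (Iwaniec (3.17)) -/

section FourierMode

open scoped Pointwise ENNReal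
open _root_.MeasureTheory Set Filter

/-- Continuity of the horocycle `x ↦ x + w₀` in `ℍ`. [folklore] -/
theorem continuous_real_vadd (w₀ : ℍ) : Continuous fun x : ℝ => ((x : ℝ) +ᵥ w₀ : ℍ) := by
  refine UpperHalfPlane.isOpenEmbedding_coe.continuous_iff.mpr ?_
  have : (UpperHalfPlane.coe ∘ fun x : ℝ => ((x : ℝ) +ᵥ w₀ : ℍ)) = fun x : ℝ => (x : ℂ) + (w₀ : ℂ) := by
    funext x; simp [UpperHalfPlane.coe_vadd]
  rw [this]
  fun_prop

/-- **The horocycle segment has bounded diameter**: `ρ(x + w₀, w₀) ≤ 2 arsinh(1/(2 Im w₀))` for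
`x ∈ [0, 1]` (`ρ = 2 arsinh(|z - w|/(2√(Im z Im w)))`). [cite: Iwaniec2002, (1.3), PDF p. 8] -/
theorem dist_real_vadd_le (w₀ : ℍ) {x : ℝ} (hx : x ∈ Icc (0 : ℝ) 1) :
    dist ((x : ℝ) +ᵥ w₀ : ℍ) w₀ ≤ 2 * Real.arsinh (1 / (2 * w₀.im)) := by
  have hy : 0 < w₀.im := w₀.im_pos
  have him : ((x : ℝ) +ᵥ w₀ : ℍ).im = w₀.im := UpperHalfPlane.vadd_im x w₀
  have hd : dist (((x : ℝ) +ᵥ w₀ : ℍ) : ℂ) (w₀ : ℂ) = |x| := by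
    rw [UpperHalfPlane.coe_vadd, Complex.dist_eq]
    simp
  rw [UpperHalfPlane.dist_eq, hd, him, show w₀.im * w₀.im = w₀.im ^ 2 by ring, Real.sqrt_sq hy.le,
    abs_of_nonneg hx.1]
  refine mul_le_mul_of_nonneg_left (Real.arsinh_le_arsinh.mpr ?_) two_pos.le
  gcongr
  exact hx.2

variable {σa σb : SL(2, ℝ)}

/-- **Uniform domination of the summands on the segment**: for `|p(v)| ≤ C (Im v)^σ` (`σ ≥ 0`),
`|p(ω_r (x + w₀))| ≤ C e^{σ D} rowIm(r, w₀)^σ` for `x ∈ [0,1]`, `D = 2 arsinh(1/(2 Im w₀))`. [folklore] -/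
theorem norm_gen_rowLift_vadd_le {p : ℍ → ℂ} {C σ : ℝ} (hσ : 0 ≤ σ) (hC : 0 ≤ C)
    (hp : ∀ v : ℍ, ‖p v‖ ≤ C * v.im ^ σ) (r : pairRows Γ σa σb) (w₀ : ℍ) {x : ℝ} (hx : x ∈ Icc (0 : ℝ) 1) :
    ‖p (rowLift Γ σa σb r.1 • ((x : ℝ) +ᵥ w₀))‖ ≤
      C * Real.exp (σ * (2 * Real.arsinh (1 / (2 * w₀.im)))) * rowIm r.1 w₀ ^ σ := by
  have h1 := norm_gen_rowLift_le hp r ((x : ℝ) +ᵥ w₀)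
  have h2 : rowIm r.1 ((x : ℝ) +ᵥ w₀) ≤ rowIm r.1 w₀ * Real.exp (2 * Real.arsinh (1 / (2 * w₀.im))) :=
    (rowIm_le_mul_exp_dist_of_mem_pairRows r.2 _ _).trans
      (mul_le_mul_of_nonneg_left (Real.exp_le_exp.mpr (dist_real_vadd_le w₀ hx)) (rowIm_nonneg _ _))
  calc ‖p (rowLift Γ σa σb r.1 • ((x : ℝ) +ᵥ w₀))‖ ≤ C * rowIm r.1 ((x : ℝ) +ᵥ w₀) ^ σ := h1
    _ ≤ C * (rowIm r.1 w₀ * Real.exp (2 * Real.arsinh (1 / (2 * w₀.im)))) ^ σ := by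
        gcongr
        exact rowIm_nonneg _ _
    _ = C * Real.exp (σ * (2 * Real.arsinh (1 / (2 * w₀.im)))) * rowIm r.1 w₀ ^ σ := by
        rw [Real.mul_rpow (rowIm_nonneg _ _) (Real.exp_pos _).le, ← Real.exp_mul]; ring

/-- Continuity of `x ↦ p(ω (x + w₀))` for continuous `p`. [folklore] -/
theorem continuous_gen_smul_vadd {p : ℍ → ℂ} (hpc : Continuous p) (ω : SL(2, ℝ)) (w₀ : ℍ) :
    Continuous fun x : ℝ => p (ω • ((x : ℝ) +ᵥ w₀)) :=
  hpc.comp ((continuous_const_smul ω).comp (continuous_real_vadd w₀))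

/-- **Interchange of the series and the period integral** (dominated convergence through
`integral_tsum`): with a bounded continuous weight `φ`,
`∫₀¹ E_𝔞(σ_𝔟(x + w₀) | p) φ(x) dx = ½ Σ_r ∫₀¹ p(ω_r(x + w₀)) φ(x) dx`. [folklore] -/
theorem intervalIntegral_poincarePair_mul
    (hΓ : Γ ≤ (Matrix.SpecialLinearGroup.toGL : SL(2, ℝ) →* GL (Fin 2) ℝ).range)
    (hd : IsDiscreteSubgroup Γ) (hTa : translSL 1 ∈ cuspPairSet Γ σa σa)
    {p : ℍ → ℂ} (hpc : Continuous p) {C σ : ℝ} (hσ : 1 < σ) (hp : ∀ v : ℍ, ‖p v‖ ≤ C * v.im ^ σ)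
    {φ : ℝ → ℂ} (hφc : Continuous φ) {B : ℝ} (hφb : ∀ x, ‖φ x‖ ≤ B) (w₀ : ℍ) :
    ∫ x in (0 : ℝ)..1, poincarePair Γ σa σb p ((x : ℝ) +ᵥ w₀) * φ x =
      (1 / 2) * ∑' r : pairRows Γ σa σb, ∫ x in (0 : ℝ)..1, p (rowLift Γ σa σb r.1 • ((x : ℝ) +ᵥ w₀)) * φ x := by
  haveI : Countable (pairRows Γ σa σb) := (countable_pairRows hd σa σb).to_subtype
  have hC : 0 ≤ C := by
    have h := hp UpperHalfPlane.I
    have hI : (UpperHalfPlane.I).im = 1 := rfl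
    rw [hI, Real.one_rpow, mul_one] at h
    exact (norm_nonneg _).trans h
  have hB : 0 ≤ B := (norm_nonneg _).trans (hφb 0)
  set D : ℝ := 2 * Real.arsinh (1 / (2 * w₀.im)) with hD
  set M : pairRows Γ σa σb → ℝ := fun r => C * Real.exp (σ * D) * rowIm r.1 w₀ ^ σ * B with hM
  have hMs : Summable M := ((summable_rowIm_rpow_pairRows hΓ hd hTa hσ w₀ (σb := σb)).mul_left
    (C * Real.exp (σ * D))).mul_right B
  have hM0 : ∀ r, 0 ≤ M r := fun r => by
    simp only [hM]; exact mul_nonneg (mul_nonneg (by positivity) (Real.rpow_nonneg (rowIm_nonneg _ _) _)) hB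
  -- pointwise bound on `(0, 1]`
  have hbound : ∀ (r : pairRows Γ σa σb) (x : ℝ), x ∈ Ioc (0 : ℝ) 1 →
      ‖p (rowLift Γ σa σb r.1 • ((x : ℝ) +ᵥ w₀)) * φ x‖ ≤ M r := by
    intro r x hx
    rw [norm_mul, hM]
    exact mul_le_mul (norm_gen_rowLift_vadd_le (by linarith) hC hp r w₀ ⟨hx.1.le, hx.2⟩) (hφb x)
      (norm_nonneg _) (hM0 r |> fun h => by
        have := mul_nonneg (mul_nonneg hC (Real.exp_pos (σ * D)).le) (Real.rpow_nonneg (rowIm_nonneg r.1 w₀) σ)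
        exact this)
  -- unfold the tsum inside the integral
  have e1 : ∀ x : ℝ, poincarePair Γ σa σb p ((x : ℝ) +ᵥ w₀) * φ x =
      (1 / 2) * ∑' r : pairRows Γ σa σb, p (rowLift Γ σa σb r.1 • ((x : ℝ) +ᵥ w₀)) * φ x := by
    intro x
    rw [poincarePair, mul_assoc, ← tsum_mul_right]
  simp_rw [e1]
  rw [intervalIntegral.integral_const_mul]
  congr 1
  rw [intervalIntegral.integral_of_le zero_le_one]
  have key := integral_tsum (μ := volume.restrict (Ioc (0 : ℝ) 1))
    (f := fun (r : pairRows Γ σa σb) (x : ℝ) => p (rowLift Γ σa σb r.1 • ((x : ℝ) +ᵥ w₀)) * φ x)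
    (fun r => ((continuous_gen_smul_vadd hpc _ w₀).mul hφc).aestronglyMeasurable) ?_
  · rw [key]
    refine tsum_congr fun r => ?_
    rw [intervalIntegral.integral_of_le zero_le_one]
  · -- `Σ_r ∫⁻ ‖·‖ₑ ≤ Σ_r M r < ∞`
    have hle : ∀ r : pairRows Γ σa σb,
        ∫⁻ x in Ioc (0 : ℝ) 1, ‖p (rowLift Γ σa σb r.1 • ((x : ℝ) +ᵥ w₀)) * φ x‖ₑ ≤ ENNReal.ofReal (M r) := by
      intro r
      calc ∫⁻ x in Ioc (0 : ℝ) 1, ‖p (rowLift Γ σa σb r.1 • ((x : ℝ) +ᵥ w₀)) * φ x‖ₑ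
          ≤ ∫⁻ _ in Ioc (0 : ℝ) 1, ENNReal.ofReal (M r) := by
            refine setLIntegral_mono' measurableSet_Ioc fun x hx => ?_
            rw [← ofReal_norm]
            exact ENNReal.ofReal_le_ofReal (hbound r x hx)
        _ = ENNReal.ofReal (M r) := by
            rw [setLIntegral_const, Real.volume_Ioc, sub_zero, ENNReal.ofReal_one, mul_one]
    refine ne_top_of_le_ne_top (ENNReal.ofReal_ne_top (r := ∑' r, M r)) ?_
    rw [ENNReal.ofReal_tsum_of_nonneg hM0 hMs]
    exact ENNReal.tsum_le_tsum hle

/-- The height along the horocycle through `w₀ = x₀ + iy₀`: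
`rowIm((c,d), t + w₀) = y₀ / ((c(t + x₀) + d)² + c²y₀²)`. [folklore] -/
theorem rowIm_real_vadd (r : Fin 2 → ℝ) (t : ℝ) (w₀ : ℍ) :
    rowIm r ((t : ℝ) +ᵥ w₀) = w₀.im / ((r 0 * (t + w₀.re) + r 1) ^ 2 + (r 0 * w₀.im) ^ 2) := by
  rw [rowIm, normSq_rowDenom, UpperHalfPlane.vadd_re, UpperHalfPlane.vadd_im]

/-- **Integrability along the horocycle for `c ≠ 0`**: `t ↦ p(ω_r(t + w₀)) φ(t)` is integrable on
`ℝ` (`|·| ≤ BC rowIm^σ ≤ K (1 + u²)⁻¹`, `u = (t + x₀ + d/c)/y₀`, a Cauchy majorant). [folklore] -/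
theorem integrable_gen_rowLift_vadd_mul {p : ℍ → ℂ} (hpc : Continuous p) {C σ : ℝ} (hσ : 1 ≤ σ)
    (hp : ∀ v : ℍ, ‖p v‖ ≤ C * v.im ^ σ) {φ : ℝ → ℂ} (hφc : Continuous φ) {B : ℝ} (hφb : ∀ x, ‖φ x‖ ≤ B)
    (r : pairRows Γ σa σb) (h0 : r.1 0 ≠ 0) (w₀ : ℍ) :
    Integrable fun t : ℝ => p (rowLift Γ σa σb r.1 • ((t : ℝ) +ᵥ w₀)) * φ t := by
  have hC : 0 ≤ C := by
    have h := hp UpperHalfPlane.I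
    have hI : (UpperHalfPlane.I).im = 1 := rfl
    rw [hI, Real.one_rpow, mul_one] at h
    exact (norm_nonneg _).trans h
  have hB : 0 ≤ B := (norm_nonneg _).trans (hφb 0)
  have hy : 0 < w₀.im := w₀.im_pos
  have hc2 : 0 < r.1 0 ^ 2 := by positivity
  have hcy : 0 < r.1 0 ^ 2 * w₀.im := mul_pos hc2 hy
  -- the height along the horocycle and its two bounds
  have him : ∀ t : ℝ, rowIm r.1 ((t : ℝ) +ᵥ w₀) =
      (1 / (r.1 0 ^ 2 * w₀.im)) * (1 + ((w₀.im)⁻¹ * (t + (w₀.re + r.1 1 / r.1 0))) ^ 2)⁻¹ := by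
    intro t
    rw [rowIm_real_vadd]
    have hden : 0 < (r.1 0 * (t + w₀.re) + r.1 1) ^ 2 + (r.1 0 * w₀.im) ^ 2 := by positivity
    have hden' : 0 < 1 + ((w₀.im)⁻¹ * (t + (w₀.re + r.1 1 / r.1 0))) ^ 2 := by positivity
    rw [div_eq_iff hden.ne', one_div, ← mul_inv, eq_comm, inv_mul_eq_iff_eq_mul₀ (mul_pos hcy hden').ne']
    field_simp
    ring
  have him_le : ∀ t : ℝ, rowIm r.1 ((t : ℝ) +ᵥ w₀) ≤ 1 / (r.1 0 ^ 2 * w₀.im) := by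
    intro t
    rw [him t]
    have h1 : (1 + ((w₀.im)⁻¹ * (t + (w₀.re + r.1 1 / r.1 0))) ^ 2)⁻¹ ≤ 1 := by
      apply inv_le_one_of_one_le₀; nlinarith
    calc (1 / (r.1 0 ^ 2 * w₀.im)) * (1 + ((w₀.im)⁻¹ * (t + (w₀.re + r.1 1 / r.1 0))) ^ 2)⁻¹
        ≤ (1 / (r.1 0 ^ 2 * w₀.im)) * 1 := by gcongr
      _ = _ := mul_one _
  -- the majorant
  set K : ℝ := C * (1 / (r.1 0 ^ 2 * w₀.im)) ^ (σ - 1) * (1 / (r.1 0 ^ 2 * w₀.im)) * B with hK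
  have hg : Integrable fun t : ℝ => K * (1 + ((w₀.im)⁻¹ * (t + (w₀.re + r.1 1 / r.1 0))) ^ 2)⁻¹ := by
    have h1 : Integrable fun t : ℝ => (1 + ((w₀.im)⁻¹ * t) ^ 2)⁻¹ :=
      integrable_inv_one_add_sq.comp_mul_left' (inv_ne_zero hy.ne')
    exact (h1.comp_add_right (w₀.re + r.1 1 / r.1 0)).const_mul K
  refine hg.mono' (((continuous_gen_smul_vadd hpc _ w₀).mul hφc).aestronglyMeasurable)
    (Eventually.of_forall fun t => ?_)
  have hIm : 0 < rowIm r.1 ((t : ℝ) +ᵥ w₀) := rowIm_pos (ne_zero_of_mem_pairRows r.2) _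
  have hpow : rowIm r.1 ((t : ℝ) +ᵥ w₀) ^ σ ≤
      (1 / (r.1 0 ^ 2 * w₀.im)) ^ (σ - 1) * rowIm r.1 ((t : ℝ) +ᵥ w₀) := by
    have e : rowIm r.1 ((t : ℝ) +ᵥ w₀) ^ σ =
        rowIm r.1 ((t : ℝ) +ᵥ w₀) ^ (σ - 1) * rowIm r.1 ((t : ℝ) +ᵥ w₀) := by
      conv_lhs => rw [show σ = (σ - 1) + 1 by ring]
      rw [Real.rpow_add hIm, Real.rpow_one]
    rw [e]
    gcongr
    exact him_le t
  calc ‖p (rowLift Γ σa σb r.1 • ((t : ℝ) +ᵥ w₀)) * φ t‖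
      = ‖p (rowLift Γ σa σb r.1 • ((t : ℝ) +ᵥ w₀))‖ * ‖φ t‖ := norm_mul _ _
    _ ≤ (C * rowIm r.1 ((t : ℝ) +ᵥ w₀) ^ σ) * B :=
        mul_le_mul (norm_gen_rowLift_le hp r _) (hφb t) (norm_nonneg _)
          (mul_nonneg hC (Real.rpow_nonneg hIm.le _))
    _ ≤ (C * ((1 / (r.1 0 ^ 2 * w₀.im)) ^ (σ - 1) * rowIm r.1 ((t : ℝ) +ᵥ w₀))) * B := by gcongr
    _ = K * (1 + ((w₀.im)⁻¹ * (t + (w₀.re + r.1 1 / r.1 0))) ^ 2)⁻¹ := by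
        rw [him t, hK]; ring

/-- A `1`-periodic weight is `ℤ`-periodic. [folklore] -/
theorem periodic_int_of_one {φ : ℝ → ℂ} (hφ1 : ∀ x, φ (x + 1) = φ x) (x : ℝ) (k : ℤ) : φ (x + k) = φ x := by
  have h : Function.Periodic φ 1 := hφ1
  have := h.int_mul k x
  rwa [mul_one] at this

variable (Γ σa σb) in
/-- The period integral of one summand against the weight: `G(r) = ∫₀¹ p(ω_r(x + w₀)) φ(x) dx`. [folklore] -/
def modeTerm (p : ℍ → ℂ) (φ : ℝ → ℂ) (w₀ : ℍ) (r : Fin 2 → ℝ) : ℂ :=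
  ∫ x in (0 : ℝ)..1, p (rowLift Γ σa σb r • ((x : ℝ) +ᵥ w₀)) * φ x

/-- The majorant `M(r) = C e^{σD} rowIm(r, w₀)^σ B` of `G(r)`. [folklore] -/
def modeMajorant (C σ B : ℝ) (w₀ : ℍ) (r : Fin 2 → ℝ) : ℝ :=
  C * Real.exp (σ * (2 * Real.arsinh (1 / (2 * w₀.im)))) * rowIm r w₀ ^ σ * B

/-- `|G(r)| ≤ M(r)`. [folklore] -/
theorem norm_modeTerm_le {p : ℍ → ℂ} {C σ : ℝ} (hσ : 0 ≤ σ) (hC : 0 ≤ C)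
    (hp : ∀ v : ℍ, ‖p v‖ ≤ C * v.im ^ σ) {φ : ℝ → ℂ} {B : ℝ} (hφb : ∀ x, ‖φ x‖ ≤ B)
    (w₀ : ℍ) (r : pairRows Γ σa σb) :
    ‖modeTerm Γ σa σb p φ w₀ r.1‖ ≤ modeMajorant C σ B w₀ r.1 := by
  have h := intervalIntegral.norm_integral_le_of_norm_le_const (a := (0 : ℝ)) (b := 1)
    (C := modeMajorant C σ B w₀ r.1)
    (f := fun x => p (rowLift Γ σa σb r.1 • ((x : ℝ) +ᵥ w₀)) * φ x) fun x hx => by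
      rw [uIoc_of_le zero_le_one] at hx
      rw [norm_mul, modeMajorant]
      exact mul_le_mul (norm_gen_rowLift_vadd_le hσ hC hp r w₀ ⟨hx.1.le, hx.2⟩) (hφb x)
        (norm_nonneg _) (mul_nonneg (mul_nonneg hC (Real.exp_pos _).le) (Real.rpow_nonneg (rowIm_nonneg _ _) _))
  simpa [modeTerm] using h

/-- `0 ≤ M(r)` for `C, B ≥ 0`. [folklore] -/
theorem modeMajorant_nonneg {C σ B : ℝ} (hC : 0 ≤ C) (hB : 0 ≤ B) (w₀ : ℍ) (r : Fin 2 → ℝ) :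
    0 ≤ modeMajorant C σ B w₀ r :=
  mul_nonneg (mul_nonneg (mul_nonneg hC (Real.exp_pos _).le) (Real.rpow_nonneg (rowIm_nonneg _ _) _)) hB

/-- Summability of the majorant on every subset of the rows. [folklore] -/
theorem summable_modeMajorant_subset
    (hΓ : Γ ≤ (Matrix.SpecialLinearGroup.toGL : SL(2, ℝ) →* GL (Fin 2) ℝ).range)
    (hd : IsDiscreteSubgroup Γ) (hTa : translSL 1 ∈ cuspPairSet Γ σa σa)
    {C σ B : ℝ} (hC : 0 ≤ C) (hσ : 1 < σ) (hB : 0 ≤ B) (w₀ : ℍ) {s : Set (Fin 2 → ℝ)}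
    (hs : s ⊆ pairRows Γ σa σb) :
    Summable fun r : s => modeMajorant C σ B w₀ r.1 := by
  have hMs : Summable fun r : pairRows Γ σa σb => modeMajorant C σ B w₀ r.1 :=
    ((summable_rowIm_rpow_pairRows hΓ hd hTa hσ w₀ (σb := σb)).mul_left
      (C * Real.exp (σ * (2 * Real.arsinh (1 / (2 * w₀.im)))))).mul_right B
  rw [show (fun r : pairRows Γ σa σb => modeMajorant C σ B w₀ r.1) =
      (modeMajorant C σ B w₀) ∘ ((↑) : pairRows Γ σa σb → (Fin 2 → ℝ)) from rfl,
    summable_subtype_iff_indicator] at hMs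
  rw [show (fun r : s => modeMajorant C σ B w₀ r.1) = (modeMajorant C σ B w₀) ∘ ((↑) : s → (Fin 2 → ℝ)) from rfl,
    summable_subtype_iff_indicator]
  refine Summable.of_nonneg_of_le (fun r => Set.indicator_nonneg (fun r _ => modeMajorant_nonneg hC hB w₀ r) r)
    (fun r => Set.indicator_le_indicator_of_subset hs (fun r => modeMajorant_nonneg hC hB w₀ r) r) hMs

/-- Summability of the period integrals on every subset of the rows. [folklore] -/
theorem summable_modeTerm_subset
    (hΓ : Γ ≤ (Matrix.SpecialLinearGroup.toGL : SL(2, ℝ) →* GL (Fin 2) ℝ).range)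
    (hd : IsDiscreteSubgroup Γ) (hTa : translSL 1 ∈ cuspPairSet Γ σa σa)
    {p : ℍ → ℂ} {C σ : ℝ} (hσ : 1 < σ) (hC : 0 ≤ C) (hp : ∀ v : ℍ, ‖p v‖ ≤ C * v.im ^ σ)
    {φ : ℝ → ℂ} {B : ℝ} (hφb : ∀ x, ‖φ x‖ ≤ B) (w₀ : ℍ) {s : Set (Fin 2 → ℝ)} (hs : s ⊆ pairRows Γ σa σb) :
    Summable fun r : s => modeTerm Γ σa σb p φ w₀ r.1 :=
  Summable.of_norm_bounded (summable_modeMajorant_subset hΓ hd hTa hC hσ ((norm_nonneg _).trans (hφb 0)) w₀ hs)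
    fun r => norm_modeTerm_le (by linarith) hC hp hφb w₀ ⟨r.1, hs r.2⟩

/-- Step 2: splitting the rows into `c = 0`, `c > 0`, `c < 0`. [folklore] -/
theorem tsum_modeTerm_split
    (hΓ : Γ ≤ (Matrix.SpecialLinearGroup.toGL : SL(2, ℝ) →* GL (Fin 2) ℝ).range)
    (hd : IsDiscreteSubgroup Γ) (hTa : translSL 1 ∈ cuspPairSet Γ σa σa)
    {p : ℍ → ℂ} {C σ : ℝ} (hσ : 1 < σ) (hC : 0 ≤ C) (hp : ∀ v : ℍ, ‖p v‖ ≤ C * v.im ^ σ)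
    {φ : ℝ → ℂ} {B : ℝ} (hφb : ∀ x, ‖φ x‖ ≤ B) (w₀ : ℍ) :
    ∑' r : pairRows Γ σa σb, modeTerm Γ σa σb p φ w₀ r.1 =
      ∑' r : zeroRows Γ σa σb, modeTerm Γ σa σb p φ w₀ r.1 +
        (∑' r : posRows Γ σa σb, modeTerm Γ σa σb p φ w₀ r.1 +
          ∑' r : negRows Γ σa σb, modeTerm Γ σa σb p φ w₀ r.1) := by
  have hz : zeroRows Γ σa σb ⊆ pairRows Γ σa σb := fun r hr => hr.1
  have hps : posRows Γ σa σb ⊆ pairRows Γ σa σb := fun r hr => hr.1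
  have hns : negRows Γ σa σb ⊆ pairRows Γ σa σb := fun r hr => hr.1
  have hpn : posRows Γ σa σb ∪ negRows Γ σa σb ⊆ pairRows Γ σa σb := Set.union_subset hps hns
  have hS := fun {s : Set (Fin 2 → ℝ)} (hs : s ⊆ pairRows Γ σa σb) =>
    summable_modeTerm_subset hΓ hd hTa hσ hC hp hφb w₀ hs (σb := σb)
  rw [tsum_congr_set_coe (modeTerm Γ σa σb p φ w₀) (pairRows_eq_union σa σb),
    Summable.tsum_union_disjoint (f := modeTerm Γ σa σb p φ w₀) (disjoint_zeroRows σa σb) (hS hz) (hS hpn),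
    Summable.tsum_union_disjoint (f := modeTerm Γ σa σb p φ w₀) (disjoint_posRows_negRows σa σb) (hS hps) (hS hns)]

/-- Step 3: the rows with `c < 0` contribute the same as those with `c > 0`. [folklore] -/
theorem tsum_modeTerm_negRows
    (hΓ : Γ ≤ (Matrix.SpecialLinearGroup.toGL : SL(2, ℝ) →* GL (Fin 2) ℝ).range)
    (hd : IsDiscreteSubgroup Γ) (hneg : (-1 : GL (Fin 2) ℝ) ∈ Γ)
    (hper : (ConjAct.toConjAct (Matrix.SpecialLinearGroup.toGL σa : GL (Fin 2) ℝ)⁻¹ • Γ).strictPeriods =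
      AddSubgroup.zmultiples (1 : ℝ))
    {p : ℍ → ℂ} (hp1 : ∀ w : ℍ, p ((1 : ℝ) +ᵥ w) = p w) (φ : ℝ → ℂ) (w₀ : ℍ) :
    ∑' r : negRows Γ σa σb, modeTerm Γ σa σb p φ w₀ r.1 =
      ∑' r : posRows Γ σa σb, modeTerm Γ σa σb p φ w₀ r.1 := by
  rw [← (negRowsEquiv hneg σa σb).tsum_eq (fun r : posRows Γ σa σb => modeTerm Γ σa σb p φ w₀ r.1)]
  refine tsum_congr fun r => ?_
  show modeTerm Γ σa σb p φ w₀ r.1 = modeTerm Γ σa σb p φ w₀ (-r.1)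
  unfold modeTerm
  refine intervalIntegral.integral_congr fun x _ => ?_
  rw [gen_rowLift_neg hΓ hd hneg hper hp1 r.2.1]

/-- Step 5: the fibre over a reduced row `ρ = (c, d)` unfolds the period integral to `ℝ`:
`Σ_k G((c, d + kc)) = ∫_ℝ p(ω_ρ(t + w₀)) φ(t) dt`. [folklore] -/
theorem tsum_modeTerm_translates
    (hΓ : Γ ≤ (Matrix.SpecialLinearGroup.toGL : SL(2, ℝ) →* GL (Fin 2) ℝ).range)
    (hd : IsDiscreteSubgroup Γ) (hneg : (-1 : GL (Fin 2) ℝ) ∈ Γ)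
    (hper : (ConjAct.toConjAct (Matrix.SpecialLinearGroup.toGL σa : GL (Fin 2) ℝ)⁻¹ • Γ).strictPeriods =
      AddSubgroup.zmultiples (1 : ℝ))
    (hTb : translSL 1 ∈ cuspPairSet Γ σb σb)
    {p : ℍ → ℂ} (hpc : Continuous p) (hp1 : ∀ w : ℍ, p ((1 : ℝ) +ᵥ w) = p w)
    {C σ : ℝ} (hσ : 1 < σ) (hp : ∀ v : ℍ, ‖p v‖ ≤ C * v.im ^ σ)
    {φ : ℝ → ℂ} (hφc : Continuous φ) (hφ1 : ∀ x, φ (x + 1) = φ x) {B : ℝ} (hφb : ∀ x, ‖φ x‖ ≤ B)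
    (w₀ : ℍ) (ρ : redRows Γ σa σb) :
    ∑' k : ℤ, modeTerm Γ σa σb p φ w₀ (redRowsProdEquiv hTb (ρ, k)).1 =
      ∫ t : ℝ, p (rowLift Γ σa σb ρ.1 • ((t : ℝ) +ᵥ w₀)) * φ t := by
  have hρ0 : 0 < ρ.1 0 := ρ.2.2.1
  have hFi : Integrable fun t : ℝ => p (rowLift Γ σa σb ρ.1 • ((t : ℝ) +ᵥ w₀)) * φ t :=
    integrable_gen_rowLift_vadd_mul hpc hσ.le hp hφc hφb ⟨ρ.1, ρ.2.1⟩ hρ0.ne' w₀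
  rw [← tsum_intervalIntegral_comp_add_int hFi]
  refine tsum_congr fun k => ?_
  rw [redRowsProdEquiv_apply]
  unfold modeTerm
  refine intervalIntegral.integral_congr fun x _ => ?_
  simp only
  rw [gen_rowLift_translate hΓ hd hneg hper hTb hp1 ρ.2.1 k, vadd_vadd, periodic_int_of_one hφ1 x k,
    add_comm (k : ℝ) x]

/-- Step 4: the rows with `c > 0` as translates of the reduced rows. [folklore] -/
theorem tsum_modeTerm_posRows
    (hΓ : Γ ≤ (Matrix.SpecialLinearGroup.toGL : SL(2, ℝ) →* GL (Fin 2) ℝ).range)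
    (hd : IsDiscreteSubgroup Γ) (hneg : (-1 : GL (Fin 2) ℝ) ∈ Γ)
    (hper : (ConjAct.toConjAct (Matrix.SpecialLinearGroup.toGL σa : GL (Fin 2) ℝ)⁻¹ • Γ).strictPeriods =
      AddSubgroup.zmultiples (1 : ℝ))
    (hTa : translSL 1 ∈ cuspPairSet Γ σa σa) (hTb : translSL 1 ∈ cuspPairSet Γ σb σb)
    {p : ℍ → ℂ} (hpc : Continuous p) (hp1 : ∀ w : ℍ, p ((1 : ℝ) +ᵥ w) = p w)
    {C σ : ℝ} (hσ : 1 < σ) (hC : 0 ≤ C) (hp : ∀ v : ℍ, ‖p v‖ ≤ C * v.im ^ σ)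
    {φ : ℝ → ℂ} (hφc : Continuous φ) (hφ1 : ∀ x, φ (x + 1) = φ x) {B : ℝ} (hφb : ∀ x, ‖φ x‖ ≤ B)
    (w₀ : ℍ) :
    ∑' r : posRows Γ σa σb, modeTerm Γ σa σb p φ w₀ r.1 =
      ∑' ρ : redRows Γ σa σb, ∫ t : ℝ, p (rowLift Γ σa σb ρ.1 • ((t : ℝ) +ᵥ w₀)) * φ t := by
  have hps : posRows Γ σa σb ⊆ pairRows Γ σa σb := fun r hr => hr.1
  set e := redRowsProdEquiv (Γ := Γ) (σa := σa) hTb with he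
  rw [← e.tsum_eq (fun r : posRows Γ σa σb => modeTerm Γ σa σb p φ w₀ r.1)]
  have hB : 0 ≤ B := (norm_nonneg _).trans (hφb 0)
  have hprodM : Summable fun q : redRows Γ σa σb × ℤ => modeMajorant C σ B w₀ (e q).1 :=
    (e.summable_iff (f := fun r : posRows Γ σa σb => modeMajorant C σ B w₀ r.1)).mpr
      (summable_modeMajorant_subset hΓ hd hTa hC hσ hB w₀ hps)
  have hprod : Summable fun q : redRows Γ σa σb × ℤ => modeTerm Γ σa σb p φ w₀ (e q).1 :=
    Summable.of_norm_bounded hprodM fun q => norm_modeTerm_le (by linarith) hC hp hφb w₀ ⟨(e q).1, hps (e q).2⟩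
  have hfib : ∀ ρ : redRows Γ σa σb, Summable fun k : ℤ => modeTerm Γ σa σb p φ w₀ (e (ρ, k)).1 := by
    intro ρ
    have hinj : Function.Injective fun k : ℤ => (ρ, k) := fun k k' h => (Prod.ext_iff.mp h).2
    exact Summable.of_norm_bounded (hprodM.comp_injective hinj)
      fun k => norm_modeTerm_le (by linarith) hC hp hφb w₀ ⟨(e (ρ, k)).1, hps (e (ρ, k)).2⟩
  rw [Summable.tsum_prod' hprod hfib]
  exact tsum_congr fun ρ => tsum_modeTerm_translates hΓ hd hneg hper hTb hpc hp1 hσ hp hφc hφ1 hφb w₀ ρ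

/-- **The Fourier modes of `E_𝔞(σ_𝔟 · | p)` along the horocycle through `w₀`, unfolded** (Iwaniec
(3.17) before the evaluation of the integrals, for a GENERAL bounded continuous `1`-periodic weight
`φ` in place of `e(-nx)`): for `Γ ≤ SL₂(ℝ)` discrete with `-1 ∈ Γ`, `σ_𝔞⁻¹Γσ_𝔞` of periods `ℤ`,
`T_1 ∈ σ_𝔟⁻¹Γσ_𝔟`, `p` continuous, `1`-periodic with `|p(v)| ≤ C (Im v)^σ`, `σ > 1`:

  `∫₀¹ E_𝔞(σ_𝔟(x + w₀) | p) φ(x) dx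
     = ½ Σ_{rows (0, d)} ∫₀¹ p(ω_{(0,d)}(x + w₀)) φ(x) dx
       + Σ_{c ∈ 𝒞_𝔞𝔟} Σ_{d (mod c)} ∫_ℝ p(ω_{(c,d)}(t + w₀)) φ(t) dt`

(the second sum over the reduced rows `(c, d)`, `c > 0`, `0 ≤ d < c`, i.e. the double cosets
`B \ σ_𝔞⁻¹Γσ_𝔟 / B`: "`Σ_{c>0} Σ_{d (mod c)} Σ_{n ∈ ℤ} p(ω_{cd}(z + n))`", the `n`-sum unfolding
the period integral to `ℝ`). [cite: Iwaniec2002, §3.4 (first two displays) & (3.17), PDF pp. 45–46] -/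
theorem intervalIntegral_poincarePair_mul_eq
    (hΓ : Γ ≤ (Matrix.SpecialLinearGroup.toGL : SL(2, ℝ) →* GL (Fin 2) ℝ).range)
    (hd : IsDiscreteSubgroup Γ) (hneg : (-1 : GL (Fin 2) ℝ) ∈ Γ)
    (hper : (ConjAct.toConjAct (Matrix.SpecialLinearGroup.toGL σa : GL (Fin 2) ℝ)⁻¹ • Γ).strictPeriods =
      AddSubgroup.zmultiples (1 : ℝ))
    (hTb : translSL 1 ∈ cuspPairSet Γ σb σb)
    {p : ℍ → ℂ} (hpc : Continuous p) (hp1 : ∀ w : ℍ, p ((1 : ℝ) +ᵥ w) = p w)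
    {C σ : ℝ} (hσ : 1 < σ) (hp : ∀ v : ℍ, ‖p v‖ ≤ C * v.im ^ σ)
    {φ : ℝ → ℂ} (hφc : Continuous φ) (hφ1 : ∀ x, φ (x + 1) = φ x) {B : ℝ} (hφb : ∀ x, ‖φ x‖ ≤ B)
    (w₀ : ℍ) :
    ∫ x in (0 : ℝ)..1, poincarePair Γ σa σb p ((x : ℝ) +ᵥ w₀) * φ x =
      (1 / 2) * (∑' r : zeroRows Γ σa σb, modeTerm Γ σa σb p φ w₀ r.1) +
        ∑' ρ : redRows Γ σa σb, ∫ t : ℝ, p (rowLift Γ σa σb ρ.1 • ((t : ℝ) +ᵥ w₀)) * φ t := by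
  have hTa : translSL 1 ∈ cuspPairSet Γ σa σa := by
    rw [← toGL_mem_conj_iff_mem_cuspPairSet, toGL_translSL, ← Subgroup.mem_strictPeriods_iff, hper]
    exact AddSubgroup.mem_zmultiples 1
  have hC : 0 ≤ C := by
    have h := hp UpperHalfPlane.I
    have hI : (UpperHalfPlane.I).im = 1 := rfl
    rw [hI, Real.one_rpow, mul_one] at h
    exact (norm_nonneg _).trans h
  rw [intervalIntegral_poincarePair_mul hΓ hd hTa hpc hσ hp hφc hφb w₀]
  change (1 / 2) * ∑' r : pairRows Γ σa σb, modeTerm Γ σa σb p φ w₀ r.1 = _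
  rw [tsum_modeTerm_split hΓ hd hTa hσ hC hp hφb w₀, tsum_modeTerm_negRows hΓ hd hneg hper hp1 φ w₀,
    tsum_modeTerm_posRows hΓ hd hneg hper hTa hTb hpc hp1 hσ hC hp hφc hφ1 hφb w₀]
  ring

end FourierMode







/-! ## 6. The rows with `c = 0`: the diagonal term `δ_𝔞𝔟 p` -/

section ZeroRows

open scoped Pointwise
open _root_.MeasureTheory Set Filter

variable {σa σb : SL(2, ℝ)}

/-- **The rows with `c = 0` of `σ_𝔞⁻¹Γσ_𝔞` are `(0, ±1)`** (`B ∩ σ_𝔞⁻¹Γσ_𝔞 = {±T_k}`: no dilations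
at a cusp, Iwaniec §2.2), for `Γ ≤ SL₂(ℝ)` discrete with `-1 ∈ Γ` and periods `ℤ` at `𝔞`.
[cite: Iwaniec2002, §2.2 & §2.4 (2.18) ("`Ω_∞ = B ω_∞ B = B` if `𝔞 = 𝔟`"), PDF pp. 29, 34] -/
theorem zeroRows_self_eq
    (hΓ : Γ ≤ (Matrix.SpecialLinearGroup.toGL : SL(2, ℝ) →* GL (Fin 2) ℝ).range)
    (hd : IsDiscreteSubgroup Γ) (hneg : (-1 : GL (Fin 2) ℝ) ∈ Γ)
    (hper : (ConjAct.toConjAct (Matrix.SpecialLinearGroup.toGL σa : GL (Fin 2) ℝ)⁻¹ • Γ).strictPeriods =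
      AddSubgroup.zmultiples (1 : ℝ)) :
    zeroRows Γ σa σa = {![(0 : ℝ), 1], ![(0 : ℝ), -1]} := by
  have h1 : (1 : SL(2, ℝ)) ∈ cuspPairSet Γ σa σa := by
    rw [mem_cuspPairSet_iff, mul_one, mul_inv_cancel, map_one]; exact Γ.one_mem
  have hrow1 : ((1 : SL(2, ℝ)) : Matrix (Fin 2) (Fin 2) ℝ) 1 = ![(0 : ℝ), 1] := by
    ext j; fin_cases j <;> simp
  ext r
  simp only [zeroRows, mem_setOf_eq, mem_insert_iff, mem_singleton_iff]
  constructor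
  · rintro ⟨⟨ω, hω, rfl⟩, h0⟩
    -- `ω` and `1` (or `-1`)… we use the `±T_k` description through the row `(0, ω 1 1)`:
    -- `ω 1 1 = ±1` since `det ω = 1` and `ω` is `±T_x`
    have h0' : (ω : Matrix (Fin 2) (Fin 2) ℝ) 1 0 = 0 := h0
    set Γa : Subgroup (GL (Fin 2) ℝ) :=
      ConjAct.toConjAct (Matrix.SpecialLinearGroup.toGL σa : GL (Fin 2) ℝ)⁻¹ • Γ with hΓa
    have hΓa_le : Γa ≤ (Matrix.SpecialLinearGroup.toGL : SL(2, ℝ) →* GL (Fin 2) ℝ).range := by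
      have h := conj_le_range hΓ σa⁻¹
      rwa [map_inv] at h
    have hΓa_d : IsDiscreteSubgroup Γa := hd.conj _
    have hT1 : Matrix.GeneralLinearGroup.upperRightHom (1 : ℝ) ∈ Γa := by
      rw [← Subgroup.mem_strictPeriods_iff, hper]; exact AddSubgroup.mem_zmultiples 1
    have hinf : IsCusp OnePoint.infty Γa := isCusp_infty_of_mem hT1
    have hmem : (Matrix.SpecialLinearGroup.toGL ω : GL (Fin 2) ℝ) ∈ Γa :=
      toGL_mem_conj_iff_mem_cuspPairSet.mpr hω
    obtain ⟨x, hx | hx⟩ := eq_upperRightHom_or_neg_of_upperTriangular hΓa_le hΓa_d hinf hmem h0'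
    · left
      have e : ω = translSL x := Matrix.SpecialLinearGroup.toGL_injective (by rw [hx, toGL_translSL])
      rw [e]; ext j; fin_cases j <;> simp
    · right
      have e : ω = -translSL x :=
        Matrix.SpecialLinearGroup.toGL_injective (by rw [hx, toGL_neg, toGL_translSL])
      rw [e]; ext j; fin_cases j <;> simp [Matrix.SpecialLinearGroup.coe_neg]
  · rintro (rfl | rfl)
    · exact ⟨⟨1, h1, hrow1⟩, by simp⟩
    · refine ⟨⟨-1, (neg_mem_cuspPairSet_iff hneg).mpr h1, ?_⟩, by simp⟩
      show ((-1 : SL(2, ℝ)) : Matrix (Fin 2) (Fin 2) ℝ) 1 = ![(0 : ℝ), -1]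
      rw [Matrix.SpecialLinearGroup.coe_neg, matrix_neg_row, hrow1]
      ext j; fin_cases j <;> simp

/-- **On the rows with `c = 0` of `σ_𝔞⁻¹Γσ_𝔞` the summand is `p` itself**: `p(ω_r v) = p(v)`
(`ω_r = ±T_k`). [cite: Iwaniec2002, §3.4 ("the first term above exists only if `𝔞` and `𝔟` are
equal"), PDF p. 45] -/
theorem gen_rowLift_of_mem_zeroRows_self
    (hΓ : Γ ≤ (Matrix.SpecialLinearGroup.toGL : SL(2, ℝ) →* GL (Fin 2) ℝ).range)
    (hd : IsDiscreteSubgroup Γ) (hneg : (-1 : GL (Fin 2) ℝ) ∈ Γ)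
    (hper : (ConjAct.toConjAct (Matrix.SpecialLinearGroup.toGL σa : GL (Fin 2) ℝ)⁻¹ • Γ).strictPeriods =
      AddSubgroup.zmultiples (1 : ℝ))
    {p : ℍ → ℂ} (hp1 : ∀ w : ℍ, p ((1 : ℝ) +ᵥ w) = p w)
    {r : Fin 2 → ℝ} (hr : r ∈ zeroRows Γ σa σa) (v : ℍ) :
    p (rowLift Γ σa σa r • v) = p v := by
  have h1 : (1 : SL(2, ℝ)) ∈ cuspPairSet Γ σa σa := by
    rw [mem_cuspPairSet_iff, mul_one, mul_inv_cancel, map_one]; exact Γ.one_mem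
  have hrow1 : ((1 : SL(2, ℝ)) : Matrix (Fin 2) (Fin 2) ℝ) 1 = ![(0 : ℝ), 1] := by
    ext j; fin_cases j <;> simp
  have hl := rowLift_mem_and_row hr.1
  rw [zeroRows_self_eq hΓ hd hneg hper] at hr
  rcases hr with rfl | rfl
  · have := gen_smul_eq_of_row_eq hΓ hd hneg hper hp1 h1 hl.1 (by rw [hl.2, hrow1]) v
    rwa [one_smul] at this
  · have hm1 : (-1 : SL(2, ℝ)) ∈ cuspPairSet Γ σa σa := (neg_mem_cuspPairSet_iff hneg).mpr h1
    have hrowm1 : ((-1 : SL(2, ℝ)) : Matrix (Fin 2) (Fin 2) ℝ) 1 = ![(0 : ℝ), -1] := by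
      rw [Matrix.SpecialLinearGroup.coe_neg, matrix_neg_row, hrow1]
      ext j; fin_cases j <;> simp
    have := gen_smul_eq_of_row_eq hΓ hd hneg hper hp1 hm1 hl.1 (by rw [hl.2, hrowm1]) v
    rwa [neg_sl_smul, one_smul] at this

/-- **The diagonal term for `𝔟 = 𝔞`**: `½ Σ_{rows (0,±1)} ∫₀¹ p(ω_r(x + w₀)) φ = ∫₀¹ p(x + w₀) φ`. [cite: Iwaniec2002, §3.4 (3.17) (the term `δ_𝔞𝔟 e(mz)ψ(y)`), PDF p. 46] -/
theorem tsum_modeTerm_zeroRows_self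
    (hΓ : Γ ≤ (Matrix.SpecialLinearGroup.toGL : SL(2, ℝ) →* GL (Fin 2) ℝ).range)
    (hd : IsDiscreteSubgroup Γ) (hneg : (-1 : GL (Fin 2) ℝ) ∈ Γ)
    (hper : (ConjAct.toConjAct (Matrix.SpecialLinearGroup.toGL σa : GL (Fin 2) ℝ)⁻¹ • Γ).strictPeriods =
      AddSubgroup.zmultiples (1 : ℝ))
    {p : ℍ → ℂ} (hp1 : ∀ w : ℍ, p ((1 : ℝ) +ᵥ w) = p w) (φ : ℝ → ℂ) (w₀ : ℍ) :
    (1 / 2) * ∑' r : zeroRows Γ σa σa, modeTerm Γ σa σa p φ w₀ r.1 =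
      ∫ x in (0 : ℝ)..1, p ((x : ℝ) +ᵥ w₀) * φ x := by
  have hval : ∀ r : zeroRows Γ σa σa, modeTerm Γ σa σa p φ w₀ r.1 = ∫ x in (0 : ℝ)..1, p ((x : ℝ) +ᵥ w₀) * φ x := by
    intro r
    unfold modeTerm
    refine intervalIntegral.integral_congr fun x _ => ?_
    rw [gen_rowLift_of_mem_zeroRows_self hΓ hd hneg hper hp1 r.2]
  rw [tsum_congr hval, tsum_const, Nat.card_coe_set_eq]
  have hne : (![(0 : ℝ), 1] : Fin 2 → ℝ) ≠ ![(0 : ℝ), -1] := by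
    intro h; have := congr_fun h 1; norm_num at this
  rw [zeroRows_self_eq hΓ hd hneg hper, Set.ncard_pair hne]
  simp

/-- **No diagonal term when `σ_𝔞⁻¹Γσ_𝔟` has no element with `c = 0`** (e.g. `𝔞`, `𝔟` inequivalent).
[cite: Iwaniec2002, §3.4 ("exists only if `𝔞` and `𝔟` are equal"), PDF p. 45] -/
theorem tsum_modeTerm_zeroRows_of_offdiag (h0 : ∀ ω ∈ cuspPairSet Γ σa σb, ω 1 0 ≠ 0)
    (p : ℍ → ℂ) (φ : ℝ → ℂ) (w₀ : ℍ) :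
    ∑' r : zeroRows Γ σa σb, modeTerm Γ σa σb p φ w₀ r.1 = 0 := by
  have he : zeroRows Γ σa σb = ∅ := by
    ext r
    simp only [zeroRows, mem_setOf_eq, mem_empty_iff_false, iff_false, not_and]
    rintro ⟨ω, hω, rfl⟩
    exact h0 ω hω
  rw [tsum_congr_set_coe (modeTerm Γ σa σb p φ w₀) he, tsum_empty]

/-- **(3.17) at the same cusp, unfolded**: `∫₀¹ E_𝔞(σ_𝔞(x + w₀) | p) φ(x) dx =
∫₀¹ p(x + w₀) φ(x) dx + Σ_{c ∈ 𝒞_𝔞𝔞} Σ_{d (mod c)} ∫_ℝ p(ω_{(c,d)}(t + w₀)) φ(t) dt`.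
[cite: Iwaniec2002, §3.4 (3.17), PDF pp. 45–46] -/
theorem intervalIntegral_poincarePair_self_mul_eq
    (hΓ : Γ ≤ (Matrix.SpecialLinearGroup.toGL : SL(2, ℝ) →* GL (Fin 2) ℝ).range)
    (hd : IsDiscreteSubgroup Γ) (hneg : (-1 : GL (Fin 2) ℝ) ∈ Γ)
    (hper : (ConjAct.toConjAct (Matrix.SpecialLinearGroup.toGL σa : GL (Fin 2) ℝ)⁻¹ • Γ).strictPeriods =
      AddSubgroup.zmultiples (1 : ℝ))
    {p : ℍ → ℂ} (hpc : Continuous p) (hp1 : ∀ w : ℍ, p ((1 : ℝ) +ᵥ w) = p w)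
    {C σ : ℝ} (hσ : 1 < σ) (hp : ∀ v : ℍ, ‖p v‖ ≤ C * v.im ^ σ)
    {φ : ℝ → ℂ} (hφc : Continuous φ) (hφ1 : ∀ x, φ (x + 1) = φ x) {B : ℝ} (hφb : ∀ x, ‖φ x‖ ≤ B)
    (w₀ : ℍ) :
    ∫ x in (0 : ℝ)..1, poincarePair Γ σa σa p ((x : ℝ) +ᵥ w₀) * φ x =
      (∫ x in (0 : ℝ)..1, p ((x : ℝ) +ᵥ w₀) * φ x) +
        ∑' ρ : redRows Γ σa σa, ∫ t : ℝ, p (rowLift Γ σa σa ρ.1 • ((t : ℝ) +ᵥ w₀)) * φ t := by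
  have hTa : translSL 1 ∈ cuspPairSet Γ σa σa := by
    rw [← toGL_mem_conj_iff_mem_cuspPairSet, toGL_translSL, ← Subgroup.mem_strictPeriods_iff, hper]
    exact AddSubgroup.mem_zmultiples 1
  rw [intervalIntegral_poincarePair_mul_eq hΓ hd hneg hper hTa hpc hp1 hσ hp hφc hφ1 hφb w₀,
    tsum_modeTerm_zeroRows_self hΓ hd hneg hper hp1 φ w₀]

/-- **(3.17) for a pair without `c = 0` elements, unfolded**:
`∫₀¹ E_𝔞(σ_𝔟(x + w₀) | p) φ(x) dx = Σ_{c ∈ 𝒞_𝔞𝔟} Σ_{d (mod c)} ∫_ℝ p(ω_{(c,d)}(t + w₀)) φ(t) dt`.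
[cite: Iwaniec2002, §3.4 (3.17), PDF pp. 45–46] -/
theorem intervalIntegral_poincarePair_mul_eq_of_offdiag
    (hΓ : Γ ≤ (Matrix.SpecialLinearGroup.toGL : SL(2, ℝ) →* GL (Fin 2) ℝ).range)
    (hd : IsDiscreteSubgroup Γ) (hneg : (-1 : GL (Fin 2) ℝ) ∈ Γ)
    (hper : (ConjAct.toConjAct (Matrix.SpecialLinearGroup.toGL σa : GL (Fin 2) ℝ)⁻¹ • Γ).strictPeriods =
      AddSubgroup.zmultiples (1 : ℝ))
    (hTb : translSL 1 ∈ cuspPairSet Γ σb σb) (h0 : ∀ ω ∈ cuspPairSet Γ σa σb, ω 1 0 ≠ 0)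
    {p : ℍ → ℂ} (hpc : Continuous p) (hp1 : ∀ w : ℍ, p ((1 : ℝ) +ᵥ w) = p w)
    {C σ : ℝ} (hσ : 1 < σ) (hp : ∀ v : ℍ, ‖p v‖ ≤ C * v.im ^ σ)
    {φ : ℝ → ℂ} (hφc : Continuous φ) (hφ1 : ∀ x, φ (x + 1) = φ x) {B : ℝ} (hφb : ∀ x, ‖φ x‖ ≤ B)
    (w₀ : ℍ) :
    ∫ x in (0 : ℝ)..1, poincarePair Γ σa σb p ((x : ℝ) +ᵥ w₀) * φ x =
      ∑' ρ : redRows Γ σa σb, ∫ t : ℝ, p (rowLift Γ σa σb ρ.1 • ((t : ℝ) +ᵥ w₀)) * φ t := by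
  rw [intervalIntegral_poincarePair_mul_eq hΓ hd hneg hper hTb hpc hp1 hσ hp hφc hφ1 hφb w₀,
    tsum_modeTerm_zeroRows_of_offdiag h0, mul_zero, zero_add]

end ZeroRows

/-! ## 7. Selberg's generating function `p(z) = ψ(y) e(mz)` and the Kloosterman sums (Iwaniec (3.17)) -/

section Selberg

open scoped Pointwise Real
open _root_.MeasureTheory Set Filter

/-- **Selberg's generating function** `p(z) = ψ(Im z) e(mz)` of the weighted Poincaré series
`E_𝔞m(z | ψ) = Σ_{γ ∈ Γ_𝔞 \ Γ} ψ(Im σ_𝔞⁻¹γz) e(m σ_𝔞⁻¹γz)` (Iwaniec §3.2; `m = 0`: incomplete /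
complete Eisenstein series, `ψ = y^s`, `m ≥ 1`: the Poincaré series `P_m(z, s)` of Selberg, Motohashi (1.1.x)).
[cite: Iwaniec2002, §3.2 (the display before (3.10)), PDF p. 42] -/
def selbergGen (ψ : ℝ → ℂ) (m : ℤ) (v : ℍ) : ℂ :=
  ψ v.im * Complex.exp (2 * π * Complex.I * m * (v : ℂ))

/-- `p(z) = ψ(y) e(mz)` is `1`-periodic. [folklore] -/
theorem selbergGen_vadd_one (ψ : ℝ → ℂ) (m : ℤ) (v : ℍ) : selbergGen ψ m ((1 : ℝ) +ᵥ v) = selbergGen ψ m v := by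
  unfold selbergGen
  rw [UpperHalfPlane.vadd_im, UpperHalfPlane.coe_vadd]
  congr 1
  push_cast
  rw [show 2 * (π : ℂ) * Complex.I * m * (1 + (v : ℂ)) = m * (2 * π * Complex.I) + 2 * π * Complex.I * m * v by ring,
    Complex.exp_add, Complex.exp_int_mul_two_pi_mul_I, one_mul]

/-- `p(z) = ψ(y) e(mz)` is continuous when `ψ` is continuous on `(0, ∞)`. [folklore] -/
theorem continuous_selbergGen {ψ : ℝ → ℂ} (hψ : ContinuousOn ψ (Ioi 0)) (m : ℤ) : Continuous (selbergGen ψ m) := by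
  unfold selbergGen
  refine (hψ.comp_continuous UpperHalfPlane.continuous_im fun v => v.im_pos).mul ?_
  exact Complex.continuous_exp.comp (continuous_const.mul UpperHalfPlane.continuous_coe)

/-- `|p(z)| = |ψ(y)| e^{-2πmy} ≤ |ψ(y)|` for `m ≥ 0`, hence `|p(z)| ≤ C y^σ` when `|ψ(u)| ≤ C u^σ`.
[cite: Iwaniec2002, §3.2 (3.9) ("for the absolute convergence it is sufficient that…"), PDF p. 42] -/
theorem norm_selbergGen_le {ψ : ℝ → ℂ} {C σ : ℝ} (hψ : ∀ u : ℝ, 0 < u → ‖ψ u‖ ≤ C * u ^ σ)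
    {m : ℤ} (hm : 0 ≤ m) (v : ℍ) : ‖selbergGen ψ m v‖ ≤ C * v.im ^ σ := by
  unfold selbergGen
  rw [norm_mul, Complex.norm_exp]
  have hre : (2 * (π : ℂ) * Complex.I * m * (v : ℂ)).re = -(2 * π * m * v.im) := by
    have e : 2 * (π : ℂ) * Complex.I * m * (v : ℂ) = ((2 * π * m : ℝ) : ℂ) * (Complex.I * (v : ℂ)) := by
      push_cast; ring
    rw [e, Complex.re_ofReal_mul, Complex.I_mul_re, UpperHalfPlane.coe_im]
    ring
  rw [hre]
  have h1 : Real.exp (-(2 * π * m * v.im)) ≤ 1 := by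
    rw [Real.exp_le_one_iff, neg_nonpos]
    have : (0 : ℝ) ≤ m := by exact_mod_cast hm
    have := v.im_pos
    positivity
  calc ‖ψ v.im‖ * Real.exp (-(2 * π * m * v.im)) ≤ ‖ψ v.im‖ * 1 := by gcongr
    _ = ‖ψ v.im‖ := mul_one _
    _ ≤ C * v.im ^ σ := hψ _ v.im_pos

/-- **The action of `ω = (a b; c d) ∈ SL₂(ℝ)`, `c ≠ 0`, on the horocycle**:
`ω(t + iy) = a/c - 1/(c(c(t + iy) + d))` (as `ad - bc = 1`). [cite: Iwaniec2002, §3.4 ("`ω_{cd}(z+t) = a/c - c⁻²(t + x + d/c + iy)⁻¹`"), PDF p. 45] -/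
theorem coe_sl_smul_eq (ω : SL(2, ℝ)) (h0 : ω 1 0 ≠ 0) (v : ℍ) :
    ((ω • v : ℍ) : ℂ) = (ω 0 0 : ℂ) / (ω 1 0 : ℂ) - 1 / ((ω 1 0 : ℂ) * ((ω 1 0 : ℂ) * (v : ℂ) + (ω 1 1 : ℂ))) := by
  rw [UpperHalfPlane.coe_specialLinearGroup_apply]
  simp only [Algebra.algebraMap_self, RingHom.id_apply]
  have hdet : ω 0 0 * ω 1 1 - ω 0 1 * ω 1 0 = 1 := by
    have := ω.prop; rw [Matrix.det_fin_two] at this; exact this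
  have hden : (ω 1 0 : ℂ) * (v : ℂ) + (ω 1 1 : ℂ) ≠ 0 := by
    have := UpperHalfPlane.linear_ne_zero v (cd := ![ω 1 0, ω 1 1]) (by simp [h0])
    simpa using this
  have hden2 : (v : ℂ) * (ω 1 0 : ℂ) + (ω 1 1 : ℂ) ≠ 0 := by rwa [mul_comm] at hden
  have hc : (ω 1 0 : ℂ) ≠ 0 := by exact_mod_cast h0
  have hdetC : (ω 0 0 : ℂ) * (ω 1 1 : ℂ) - (ω 0 1 : ℂ) * (ω 1 0 : ℂ) = 1 := by exact_mod_cast hdet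
  rw [div_sub_div _ _ hc (mul_ne_zero hc hden), div_eq_div_iff hden (mul_ne_zero hc (mul_ne_zero hc hden))]
  linear_combination (-(ω 1 0 : ℂ) * ((ω 1 0 : ℂ) * (v : ℂ) + (ω 1 1 : ℂ))) * hdetC

/-- The height along the horocycle through `iy`: `Im ω(t + iy) = y/((ct + d)² + c²y²)`. [folklore] -/
theorem im_sl_smul_real_vadd_I (ω : SL(2, ℝ)) (t : ℝ) {y : ℝ} (hy : 0 < y) :
    (ω • ((t : ℝ) +ᵥ UpperHalfPlane.ofComplex ⟨0, y⟩)).im =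
      y / ((ω 1 0 * t + ω 1 1) ^ 2 + (ω 1 0 * y) ^ 2) := by
  rw [im_sl_smul_eq_rowIm, rowIm_real_vadd]
  have hre : (UpperHalfPlane.ofComplex (⟨0, y⟩ : ℂ)).re = 0 := by
    rw [UpperHalfPlane.ofComplex_apply_of_im_pos (z := (⟨0, y⟩ : ℂ)) hy]; rfl
  have him : (UpperHalfPlane.ofComplex (⟨0, y⟩ : ℂ)).im = y := by
    rw [UpperHalfPlane.ofComplex_apply_of_im_pos (z := (⟨0, y⟩ : ℂ)) hy]; rfl
  rw [hre, him, add_zero]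

/-- **Iwaniec's integral in (3.17)**:
`I_c(y) = ∫_ℝ ψ(y c⁻²/(t² + y²)) e(-m c⁻²/(t + iy)) e(-nt) dt`.
[cite: Iwaniec2002, §3.4 (3.17), PDF p. 46] -/
def poincareModeIntegral (ψ : ℝ → ℂ) (m n : ℤ) (c y : ℝ) : ℂ :=
  ∫ t : ℝ, ψ (y / (c ^ 2 * (t ^ 2 + y ^ 2))) *
    Complex.exp (-(2 * π * Complex.I * m / ((c : ℂ) ^ 2 * ((t : ℂ) + Complex.I * y)))) *
      Complex.exp (-(2 * π * Complex.I * n * t))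

/-- The coercion of the point `t + iy` of the horocycle. [folklore] -/
theorem coe_real_vadd_ofComplex (t : ℝ) {y : ℝ} (hy : 0 < y) :
    ((((t : ℝ) +ᵥ UpperHalfPlane.ofComplex ⟨0, y⟩) : ℍ) : ℂ) = (t : ℂ) + Complex.I * y := by
  rw [UpperHalfPlane.coe_vadd, UpperHalfPlane.ofComplex_apply_of_im_pos (z := (⟨0, y⟩ : ℂ)) hy]
  apply Complex.ext <;> simp

/-- **The summand on the shifted horocycle** (`t ↦ t - d/c`): for `ω = (a ∗; c d)`, `c ≠ 0`,
`p(ω(t - d/c + iy)) e(-n(t - d/c)) = e((ma + nd)/c) · ψ(y/(c²(t²+y²))) e(-m/(c²(t+iy))) e(-nt)`.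
[cite: Iwaniec2002, §3.4 ("Changing `t ↦ t - x - d/c`, the Fourier integral becomes…"), PDF pp. 45–46] -/
theorem selbergGen_smul_shift_mul (ψ : ℝ → ℂ) (m n : ℤ) (ω : SL(2, ℝ)) (h0 : ω 1 0 ≠ 0)
    {y : ℝ} (hy : 0 < y) (t : ℝ) :
    selbergGen ψ m (ω • (((t - ω 1 1 / ω 1 0 : ℝ)) +ᵥ UpperHalfPlane.ofComplex ⟨0, y⟩)) *
        Complex.exp (-(2 * π * Complex.I * n * ((t - ω 1 1 / ω 1 0 : ℝ) : ℂ))) =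
      Complex.exp (2 * π * Complex.I * ((m * ω 0 0 + n * ω 1 1) / ω 1 0 : ℝ)) *
        (ψ (y / (ω 1 0 ^ 2 * (t ^ 2 + y ^ 2))) *
          Complex.exp (-(2 * π * Complex.I * m / ((ω 1 0 : ℂ) ^ 2 * ((t : ℂ) + Complex.I * y)))) *
            Complex.exp (-(2 * π * Complex.I * n * t))) := by
  have hc : (ω 1 0 : ℂ) ≠ 0 := by exact_mod_cast h0
  have hty : (t : ℂ) + Complex.I * y ≠ 0 := by
    intro h
    have := congr_arg Complex.im h
    simp at this
    exact hy.ne' this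
  unfold selbergGen
  rw [im_sl_smul_real_vadd_I ω _ hy, coe_sl_smul_eq ω h0, coe_real_vadd_ofComplex _ hy]
  -- the argument of `ψ`
  have e1 : y / ((ω 1 0 * (t - ω 1 1 / ω 1 0) + ω 1 1) ^ 2 + (ω 1 0 * y) ^ 2) =
      y / (ω 1 0 ^ 2 * (t ^ 2 + y ^ 2)) := by
    congr 1
    field_simp
    ring
  rw [e1]
  -- the exponentials
  have e2 : (ω 1 0 : ℂ) * (((t - ω 1 1 / ω 1 0 : ℝ) : ℂ) + Complex.I * y) + (ω 1 1 : ℂ) =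
      (ω 1 0 : ℂ) * ((t : ℂ) + Complex.I * y) := by
    push_cast
    field_simp
    ring
  rw [e2]
  rw [mul_assoc (ψ _), mul_assoc (ψ _), mul_left_comm (Complex.exp _) (ψ _)]
  congr 1
  rw [← Complex.exp_add, ← Complex.exp_add, ← Complex.exp_add]
  congr 1
  push_cast
  field_simp
  ring

/-- **The integral of one double coset** (Iwaniec (3.17), the `(c, d)`-term): for `ω = (a ∗; c d)`
with `c ≠ 0`,
`∫_ℝ p(ω(t + iy)) e(-nt) dt = e((ma + nd)/c) ∫_ℝ ψ(yc⁻²/(t²+y²)) e(-mc⁻²/(t+iy) - nt) dt`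
(substitute `t ↦ t - d/c`). [cite: Iwaniec2002, §3.4 (3.17), PDF pp. 45–46] -/
theorem integral_selbergGen_smul_mul (ψ : ℝ → ℂ) (m n : ℤ) (ω : SL(2, ℝ)) (h0 : ω 1 0 ≠ 0)
    {y : ℝ} (hy : 0 < y) :
    ∫ t : ℝ, selbergGen ψ m (ω • ((t : ℝ) +ᵥ UpperHalfPlane.ofComplex ⟨0, y⟩)) *
        Complex.exp (-(2 * π * Complex.I * n * t)) =
      Complex.exp (2 * π * Complex.I * ((m * ω 0 0 + n * ω 1 1) / ω 1 0 : ℝ)) *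
        poincareModeIntegral ψ m n (ω 1 0) y := by
  rw [← integral_sub_right_eq_self (fun t : ℝ => selbergGen ψ m (ω • ((t : ℝ) +ᵥ UpperHalfPlane.ofComplex ⟨0, y⟩)) *
      Complex.exp (-(2 * π * Complex.I * n * t))) (ω 1 1 / ω 1 0)]
  simp_rw [selbergGen_smul_shift_mul ψ m n ω h0 hy]
  rw [MeasureTheory.integral_const_mul]
  rfl

variable {σa σb : SL(2, ℝ)}

/-- **The phase of a double coset is a term of the Kloosterman sum**: for the chosen element
`ω_ρ = (a ∗; c d)` of a reduced row `ρ = (c, d)`, `e((ma + nd)/c) = e((n·d + m·topLeft(c,d))/c)`,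
the summand of `S_𝔞𝔟(n, m; c)` in the convention of (2.23) (`S_𝔞𝔟(m,n;c) = Σ e((md + na)/c)`):
NOTE the transposition — (3.17)'s phase `e(n d/c + m a/c)` is, literally by (2.23), the summand of
`S_𝔞𝔟(n, m; c)` (the book writes `S_𝔞𝔟(m, n; c)` in (3.17) and (3.22), tacitly in the convention
`e((am + dn)/c)` of [DeshouillersIwaniec1982]/[IwaniecKowalski]). [cite: Iwaniec2002, (2.23) & (3.17), PDF pp. 36, 46] -/
theorem cexp_phase_eq_kloostermanTerm
    (hΓ : Γ ≤ (Matrix.SpecialLinearGroup.toGL : SL(2, ℝ) →* GL (Fin 2) ℝ).range)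
    (hd : IsDiscreteSubgroup Γ)
    (hper : (ConjAct.toConjAct (Matrix.SpecialLinearGroup.toGL σa : GL (Fin 2) ℝ)⁻¹ • Γ).strictPeriods =
      AddSubgroup.zmultiples (1 : ℝ))
    (m n : ℤ) (ρ : redRows Γ σa σb) :
    Complex.exp (2 * π * Complex.I *
        ((m * (rowLift Γ σa σb ρ.1) 0 0 + n * (rowLift Γ σa σb ρ.1) 1 1) / (rowLift Γ σa σb ρ.1) 1 0 : ℝ)) =
      kloostermanTerm (Γ := Γ) σa σb n m (ρ.1 0) (ρ.1 1) := by
  have hl := rowLift_mem_and_row ρ.2.1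
  have h10 : (rowLift Γ σa σb ρ.1) 1 0 = ρ.1 0 := congr_fun hl.2 0
  have h11 : (rowLift Γ σa σb ρ.1) 1 1 = ρ.1 1 := congr_fun hl.2 1
  have hc : (rowLift Γ σa σb ρ.1) 1 0 ≠ 0 := by rw [h10]; exact ρ.2.2.1.ne'
  rw [← h10, ← h11, kloostermanTerm_eq_of_mem hΓ hd hper hl.1 hc n m, Real.fourierChar_apply]
  congr 1
  push_cast
  ring

/-- **Summability over the double cosets** of the unfolded integrals `∫_ℝ p(ω_{(c,d)}(t + w₀)) φ(t) dt`
(their sum is dominated by `Σ_{rows, c > 0} M(r)`). [folklore] -/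
theorem summable_integral_redRows
    (hΓ : Γ ≤ (Matrix.SpecialLinearGroup.toGL : SL(2, ℝ) →* GL (Fin 2) ℝ).range)
    (hd : IsDiscreteSubgroup Γ) (hneg : (-1 : GL (Fin 2) ℝ) ∈ Γ)
    (hper : (ConjAct.toConjAct (Matrix.SpecialLinearGroup.toGL σa : GL (Fin 2) ℝ)⁻¹ • Γ).strictPeriods =
      AddSubgroup.zmultiples (1 : ℝ))
    (hTb : translSL 1 ∈ cuspPairSet Γ σb σb)
    {p : ℍ → ℂ} (hpc : Continuous p) (hp1 : ∀ w : ℍ, p ((1 : ℝ) +ᵥ w) = p w)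
    {C σ : ℝ} (hσ : 1 < σ) (hp : ∀ v : ℍ, ‖p v‖ ≤ C * v.im ^ σ)
    {φ : ℝ → ℂ} (hφc : Continuous φ) (hφ1 : ∀ x, φ (x + 1) = φ x) {B : ℝ} (hφb : ∀ x, ‖φ x‖ ≤ B)
    (w₀ : ℍ) :
    Summable fun ρ : redRows Γ σa σb => ∫ t : ℝ, p (rowLift Γ σa σb ρ.1 • ((t : ℝ) +ᵥ w₀)) * φ t := by
  have hTa : translSL 1 ∈ cuspPairSet Γ σa σa := by
    rw [← toGL_mem_conj_iff_mem_cuspPairSet, toGL_translSL, ← Subgroup.mem_strictPeriods_iff, hper]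
    exact AddSubgroup.mem_zmultiples 1
  have hC : 0 ≤ C := by
    have h := hp UpperHalfPlane.I
    have hI : (UpperHalfPlane.I).im = 1 := rfl
    rw [hI, Real.one_rpow, mul_one] at h
    exact (norm_nonneg _).trans h
  have hB : 0 ≤ B := (norm_nonneg _).trans (hφb 0)
  have hps : posRows Γ σa σb ⊆ pairRows Γ σa σb := fun r hr => hr.1
  set e := redRowsProdEquiv (Γ := Γ) (σa := σa) hTb with he
  have hprodM : Summable fun q : redRows Γ σa σb × ℤ => modeMajorant C σ B w₀ (e q).1 :=
    (e.summable_iff (f := fun r : posRows Γ σa σb => modeMajorant C σ B w₀ r.1)).mpr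
      (summable_modeMajorant_subset hΓ hd hTa hC hσ hB w₀ hps)
  have hprod : Summable fun q : redRows Γ σa σb × ℤ => modeTerm Γ σa σb p φ w₀ (e q).1 :=
    Summable.of_norm_bounded hprodM fun q => norm_modeTerm_le (by linarith) hC hp hφb w₀ ⟨(e q).1, hps (e q).2⟩
  refine (hprod.prod).congr fun ρ => ?_
  exact tsum_modeTerm_translates hΓ hd hneg hper hTb hpc hp1 hσ hp hφc hφ1 hφb w₀ ρ

/-- The double cosets `(c, d)` as pairs: `redRows ≃ Σ c ∈ 𝒞_𝔞𝔟, bottomReps c`. [folklore] -/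
def redRowsSigmaEquiv (σa σb : SL(2, ℝ)) :
    redRows Γ σa σb ≃ Σ c : kloostermanModuli Γ σa σb, bottomReps Γ σa σb c.1 where
  toFun ρ := ⟨⟨ρ.1 0, (mem_redRows_iff.mp ρ.2).1⟩, ⟨ρ.1 1, (mem_redRows_iff.mp ρ.2).2⟩⟩
  invFun q := ⟨![q.1.1, q.2.1], mem_redRows_iff.mpr
    ⟨show q.1.1 ∈ kloostermanModuli Γ σa σb from q.1.2, show q.2.1 ∈ bottomReps Γ σa σb q.1.1 from q.2.2⟩⟩
  left_inv ρ := by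
    apply Subtype.ext
    ext j; fin_cases j <;> rfl
  right_inv q := by
    obtain ⟨⟨c, hc⟩, ⟨d, hd⟩⟩ := q
    rfl

/-- **The Kloosterman sums appear** (Iwaniec: "Summing over the coset representatives `c, d`, we
encounter the Kloosterman sum"): for `p = ψ(y)e(mz)`, `φ = e(-n·)` and the horocycle through `iy`,
`Σ_{(c,d)} ∫_ℝ p(ω_{(c,d)}(t + iy)) e(-nt) dt = Σ_{c ∈ 𝒞_𝔞𝔟} S_𝔞𝔟(n, m; c) I_c(y)` with the
Kloosterman sum `cuspKloosterman σ_𝔞 σ_𝔟 n m c` of the tree ((2.23); see the NOTE at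
`cexp_phase_eq_kloostermanTerm` on the transposed arguments) and
`I_c(y) = ∫_ℝ ψ(yc⁻²/(t²+y²)) e(-mc⁻²/(t+iy) - nt) dt`. [cite: Iwaniec2002, §3.4 (3.17), PDF p. 46] -/
theorem tsum_integral_redRows_selbergGen
    (hΓ : Γ ≤ (Matrix.SpecialLinearGroup.toGL : SL(2, ℝ) →* GL (Fin 2) ℝ).range)
    (hd : IsDiscreteSubgroup Γ) (hneg : (-1 : GL (Fin 2) ℝ) ∈ Γ)
    (hper : (ConjAct.toConjAct (Matrix.SpecialLinearGroup.toGL σa : GL (Fin 2) ℝ)⁻¹ • Γ).strictPeriods =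
      AddSubgroup.zmultiples (1 : ℝ))
    (hTb : translSL 1 ∈ cuspPairSet Γ σb σb)
    {ψ : ℝ → ℂ} (hψc : ContinuousOn ψ (Ioi 0)) {C σ : ℝ} (hσ : 1 < σ)
    (hψ : ∀ u : ℝ, 0 < u → ‖ψ u‖ ≤ C * u ^ σ) {m : ℤ} (hm : 0 ≤ m) (n : ℤ) {y : ℝ} (hy : 0 < y) :
    ∑' ρ : redRows Γ σa σb, ∫ t : ℝ,
        selbergGen ψ m (rowLift Γ σa σb ρ.1 • ((t : ℝ) +ᵥ UpperHalfPlane.ofComplex ⟨0, y⟩)) *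
          Complex.exp (-(2 * π * Complex.I * n * t)) =
      ∑' c : kloostermanModuli Γ σa σb, cuspKloosterman Γ σa σb n m c.1 * poincareModeIntegral ψ m n c.1 y := by
  have hTa : translSL 1 ∈ cuspPairSet Γ σa σa := by
    rw [← toGL_mem_conj_iff_mem_cuspPairSet, toGL_translSL, ← Subgroup.mem_strictPeriods_iff, hper]
    exact AddSubgroup.mem_zmultiples 1
  -- each term: Kloosterman phase × Iwaniec's integral
  have hterm : ∀ ρ : redRows Γ σa σb,
      (∫ t : ℝ, selbergGen ψ m (rowLift Γ σa σb ρ.1 • ((t : ℝ) +ᵥ UpperHalfPlane.ofComplex ⟨0, y⟩)) *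
          Complex.exp (-(2 * π * Complex.I * n * t))) =
        kloostermanTerm (Γ := Γ) σa σb n m (ρ.1 0) (ρ.1 1) * poincareModeIntegral ψ m n (ρ.1 0) y := by
    intro ρ
    have hl := rowLift_mem_and_row ρ.2.1
    have h10 : (rowLift Γ σa σb ρ.1) 1 0 = ρ.1 0 := congr_fun hl.2 0
    have hc : (rowLift Γ σa σb ρ.1) 1 0 ≠ 0 := by rw [h10]; exact ρ.2.2.1.ne'
    rw [integral_selbergGen_smul_mul ψ m n _ hc hy, cexp_phase_eq_kloostermanTerm hΓ hd hper m n ρ, h10]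
  rw [tsum_congr hterm]
  -- summability (from the general unfolding) and regrouping by the modulus `c`
  have hsum : Summable fun ρ : redRows Γ σa σb =>
      kloostermanTerm (Γ := Γ) σa σb n m (ρ.1 0) (ρ.1 1) * poincareModeIntegral ψ m n (ρ.1 0) y := by
    have h := summable_integral_redRows hΓ hd hneg hper hTb (continuous_selbergGen hψc m) (selbergGen_vadd_one ψ m)
      hσ (norm_selbergGen_le hψ hm) (φ := fun t : ℝ => Complex.exp (-(2 * π * Complex.I * n * t)))
      (by fun_prop) (fun x => by
        rw [show -(2 * (π : ℂ) * Complex.I * n * ((x + 1 : ℝ) : ℂ)) =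
            -(2 * π * Complex.I * n * (x : ℂ)) + (-n : ℤ) * (2 * π * Complex.I) by push_cast; ring,
          Complex.exp_add, Complex.exp_int_mul_two_pi_mul_I, mul_one])
      (B := 1) (fun x => by rw [Complex.norm_exp]; simp) (UpperHalfPlane.ofComplex ⟨0, y⟩)
    exact h.congr hterm
  set g : (Σ c : kloostermanModuli Γ σa σb, bottomReps Γ σa σb c.1) → ℂ := fun q =>
    kloostermanTerm (Γ := Γ) σa σb n m q.1.1 q.2.1 * poincareModeIntegral ψ m n q.1.1 y with hg
  have e_tsum : ∑' ρ : redRows Γ σa σb,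
      kloostermanTerm (Γ := Γ) σa σb n m (ρ.1 0) (ρ.1 1) * poincareModeIntegral ψ m n (ρ.1 0) y =
        ∑' q, g q := by
    rw [← (redRowsSigmaEquiv σa σb).tsum_eq g]
    rfl
  rw [e_tsum]
  have hsumg : Summable g :=
    ((redRowsSigmaEquiv σa σb).summable_iff (f := g)).mp (by exact hsum)
  have hfib : ∀ c : kloostermanModuli Γ σa σb, Summable fun d : bottomReps Γ σa σb c.1 => g ⟨c, d⟩ := by
    intro c
    haveI : Finite (bottomReps Γ σa σb c.1) := (finite_bottomReps hΓ hd hTa c.2.1).to_subtype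
    exact Summable.of_finite
  rw [Summable.tsum_sigma' hfib hsumg]
  refine tsum_congr fun c => ?_
  have hfin : (bottomReps Γ σa σb c.1).Finite := finite_bottomReps hΓ hd hTa c.2.1
  simp only [hg]
  rw [tsum_mul_right, cuspKloosterman_eq_sum hfin]
  congr 1
  rw [tsum_subtype (bottomReps Γ σa σb c.1) (fun d : ℝ => kloostermanTerm (Γ := Γ) σa σb n m c.1 d),
    tsum_eq_sum (s := hfin.toFinset) (fun b hb => Set.indicator_of_notMem (by simpa using hb) _)]
  exact Finset.sum_congr rfl (fun d hd => Set.indicator_of_mem (by simpa using hd) _)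

/-- **The diagonal integral**: `∫₀¹ ψ(y) e(m(x+iy)) e(-nx) dx = δ_{mn} ψ(y) e^{-2πmy}`. [cite: Iwaniec2002, §3.4 (3.17) (the term `δ_𝔞𝔟 e(mz)ψ(y)`), PDF p. 46] -/
theorem intervalIntegral_selbergGen_vadd_mul (ψ : ℝ → ℂ) (m n : ℤ) {y : ℝ} (hy : 0 < y) :
    ∫ x in (0 : ℝ)..1, selbergGen ψ m ((x : ℝ) +ᵥ UpperHalfPlane.ofComplex ⟨0, y⟩) *
        Complex.exp (-(2 * π * Complex.I * n * x)) =
      if n = m then ψ y * Complex.exp (-(2 * π * m * y)) else 0 := by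
  have him : ∀ x : ℝ, (((x : ℝ) +ᵥ UpperHalfPlane.ofComplex ⟨0, y⟩ : ℍ)).im = y := by
    intro x
    rw [UpperHalfPlane.vadd_im, UpperHalfPlane.ofComplex_apply_of_im_pos (z := (⟨0, y⟩ : ℂ)) hy]; rfl
  have e : ∀ x : ℝ, selbergGen ψ m ((x : ℝ) +ᵥ UpperHalfPlane.ofComplex ⟨0, y⟩) *
      Complex.exp (-(2 * π * Complex.I * n * x)) =
        (ψ y * Complex.exp (-(2 * π * m * y))) * Complex.exp ((2 * π * Complex.I * (m - n) : ℂ) * x) := by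
    intro x
    unfold selbergGen
    rw [him, coe_real_vadd_ofComplex _ hy]
    simp only [mul_assoc, ← Complex.exp_add]
    congr 2
    have hI : Complex.I * Complex.I = -1 := Complex.I_mul_I
    linear_combination (2 * (π : ℂ) * (m * y)) * hI
  simp_rw [e]
  rw [intervalIntegral.integral_const_mul]
  split_ifs with hnm
  · subst hnm
    simp
  · have hc : (2 * π * Complex.I * (m - n) : ℂ) ≠ 0 := by
      have : ((m : ℂ) - n) ≠ 0 := by
        rw [sub_ne_zero]; exact_mod_cast (Ne.symm hnm)
      have hπ : (π : ℂ) ≠ 0 := by exact_mod_cast Real.pi_ne_zero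
      simp [Complex.I_ne_zero, this, hπ]
    rw [integral_exp_mul_complex hc]
    have h1 : Complex.exp ((2 * π * Complex.I * (m - n) : ℂ) * (1 : ℝ)) = 1 := by
      rw [show (2 * π * Complex.I * (m - n) : ℂ) * (1 : ℝ) = ((m - n : ℤ) : ℂ) * (2 * π * Complex.I) by push_cast; ring,
        Complex.exp_int_mul_two_pi_mul_I]
    rw [h1]
    simp

/-- **Iwaniec (3.17) for the Fourier modes of the Selberg–Poincaré series `E_𝔞m(· | ψ)` at a cusp
`𝔟` with `σ_𝔞⁻¹Γσ_𝔟` free of upper-triangular elements** (e.g. `𝔞`, `𝔟` inequivalent): for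
`m ≥ 0`, every `n ∈ ℤ` and `y > 0`,

  `∫₀¹ E_𝔞m(σ_𝔟(x + iy) | ψ) e(-nx) dx = Σ_{c ∈ 𝒞_𝔞𝔟} S_𝔞𝔟(n, m; c) ∫_ℝ ψ(yc⁻²/(t²+y²)) e(-mc⁻²/(t+iy) - nt) dt`

(Kloosterman sums `cuspKloosterman σ_𝔞 σ_𝔟 n m c` in the convention (2.23) of the tree — the book's
`S_𝔞𝔟(m, n; c)` of (3.17) in the transposed convention, see `cexp_phase_eq_kloostermanTerm`), for
`Γ ≤ SL₂(ℝ)` discrete, `-1 ∈ Γ`, periods `ℤ` at `𝔞`, `T_1 ∈ σ_𝔟⁻¹Γσ_𝔟`, `ψ` continuous on `(0,∞)`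
with `|ψ(u)| ≤ C u^σ`, `σ > 1` ((3.9)). [cite: Iwaniec2002, §3.4 (3.17), PDF pp. 45–46] -/
theorem fourierMode_poincarePair_selbergGen_of_offdiag
    (hΓ : Γ ≤ (Matrix.SpecialLinearGroup.toGL : SL(2, ℝ) →* GL (Fin 2) ℝ).range)
    (hd : IsDiscreteSubgroup Γ) (hneg : (-1 : GL (Fin 2) ℝ) ∈ Γ)
    (hper : (ConjAct.toConjAct (Matrix.SpecialLinearGroup.toGL σa : GL (Fin 2) ℝ)⁻¹ • Γ).strictPeriods =
      AddSubgroup.zmultiples (1 : ℝ))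
    (hTb : translSL 1 ∈ cuspPairSet Γ σb σb) (h0 : ∀ ω ∈ cuspPairSet Γ σa σb, ω 1 0 ≠ 0)
    {ψ : ℝ → ℂ} (hψc : ContinuousOn ψ (Ioi 0)) {C σ : ℝ} (hσ : 1 < σ)
    (hψ : ∀ u : ℝ, 0 < u → ‖ψ u‖ ≤ C * u ^ σ) {m : ℤ} (hm : 0 ≤ m) (n : ℤ) {y : ℝ} (hy : 0 < y) :
    ∫ x in (0 : ℝ)..1, poincarePair Γ σa σb (selbergGen ψ m) ((x : ℝ) +ᵥ UpperHalfPlane.ofComplex ⟨0, y⟩) *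
        Complex.exp (-(2 * π * Complex.I * n * x)) =
      ∑' c : kloostermanModuli Γ σa σb, cuspKloosterman Γ σa σb n m c.1 * poincareModeIntegral ψ m n c.1 y := by
  have hφ1 : ∀ x : ℝ, Complex.exp (-(2 * π * Complex.I * n * ((x + 1 : ℝ) : ℂ))) =
      Complex.exp (-(2 * π * Complex.I * n * (x : ℂ))) := by
    intro x
    rw [show -(2 * (π : ℂ) * Complex.I * n * ((x + 1 : ℝ) : ℂ)) =
        -(2 * π * Complex.I * n * (x : ℂ)) + (-n : ℤ) * (2 * π * Complex.I) by push_cast; ring,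
      Complex.exp_add, Complex.exp_int_mul_two_pi_mul_I, mul_one]
  rw [intervalIntegral_poincarePair_mul_eq_of_offdiag hΓ hd hneg hper hTb h0 (continuous_selbergGen hψc m)
    (selbergGen_vadd_one ψ m) hσ (norm_selbergGen_le hψ hm) (φ := fun t : ℝ => Complex.exp (-(2 * π * Complex.I * n * t)))
    (by fun_prop) hφ1 (B := 1) (fun x => by rw [Complex.norm_exp]; simp) (UpperHalfPlane.ofComplex ⟨0, y⟩)]
  exact tsum_integral_redRows_selbergGen hΓ hd hneg hper hTb hψc hσ hψ hm n hy

/-- **Iwaniec (3.17) for the Fourier modes of `E_𝔞m(· | ψ)` at the cusp `𝔞` itself**: for `m ≥ 0`,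
every `n ∈ ℤ` and `y > 0`,

  `∫₀¹ E_𝔞m(σ_𝔞(x + iy) | ψ) e(-nx) dx
     = δ_{mn} ψ(y) e^{-2πmy} + Σ_{c ∈ 𝒞_𝔞𝔞} S_𝔞𝔞(n, m; c) ∫_ℝ ψ(yc⁻²/(t²+y²)) e(-mc⁻²/(t+iy) - nt) dt`

(conventions and hypotheses as in `fourierMode_poincarePair_selbergGen_of_offdiag`). With `ψ = y^s`,
`m ≥ 1` these are the Fourier coefficients of Selberg's Poincaré series (Motohashi (1.1.5)–(1.1.6));
with `m = 0`, `ψ = y^s` those of the Eisenstein series (Theorem 3.4 before the evaluation (3.18)–(3.19)).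
[cite: Iwaniec2002, §3.4 (3.17), PDF pp. 45–46] -/
theorem fourierMode_poincarePair_selbergGen_self
    (hΓ : Γ ≤ (Matrix.SpecialLinearGroup.toGL : SL(2, ℝ) →* GL (Fin 2) ℝ).range)
    (hd : IsDiscreteSubgroup Γ) (hneg : (-1 : GL (Fin 2) ℝ) ∈ Γ)
    (hper : (ConjAct.toConjAct (Matrix.SpecialLinearGroup.toGL σa : GL (Fin 2) ℝ)⁻¹ • Γ).strictPeriods =
      AddSubgroup.zmultiples (1 : ℝ))
    {ψ : ℝ → ℂ} (hψc : ContinuousOn ψ (Ioi 0)) {C σ : ℝ} (hσ : 1 < σ)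
    (hψ : ∀ u : ℝ, 0 < u → ‖ψ u‖ ≤ C * u ^ σ) {m : ℤ} (hm : 0 ≤ m) (n : ℤ) {y : ℝ} (hy : 0 < y) :
    ∫ x in (0 : ℝ)..1, poincarePair Γ σa σa (selbergGen ψ m) ((x : ℝ) +ᵥ UpperHalfPlane.ofComplex ⟨0, y⟩) *
        Complex.exp (-(2 * π * Complex.I * n * x)) =
      (if n = m then ψ y * Complex.exp (-(2 * π * m * y)) else 0) +
        ∑' c : kloostermanModuli Γ σa σa, cuspKloosterman Γ σa σa n m c.1 * poincareModeIntegral ψ m n c.1 y := by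
  have hTa : translSL 1 ∈ cuspPairSet Γ σa σa := by
    rw [← toGL_mem_conj_iff_mem_cuspPairSet, toGL_translSL, ← Subgroup.mem_strictPeriods_iff, hper]
    exact AddSubgroup.mem_zmultiples 1
  have hφ1 : ∀ x : ℝ, Complex.exp (-(2 * π * Complex.I * n * ((x + 1 : ℝ) : ℂ))) =
      Complex.exp (-(2 * π * Complex.I * n * (x : ℂ))) := by
    intro x
    rw [show -(2 * (π : ℂ) * Complex.I * n * ((x + 1 : ℝ) : ℂ)) =
        -(2 * π * Complex.I * n * (x : ℂ)) + (-n : ℤ) * (2 * π * Complex.I) by push_cast; ring,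
      Complex.exp_add, Complex.exp_int_mul_two_pi_mul_I, mul_one]
  rw [intervalIntegral_poincarePair_self_mul_eq hΓ hd hneg hper (continuous_selbergGen hψc m)
    (selbergGen_vadd_one ψ m) hσ (norm_selbergGen_le hψ hm) (φ := fun t : ℝ => Complex.exp (-(2 * π * Complex.I * n * t)))
    (by fun_prop) hφ1 (B := 1) (fun x => by rw [Complex.norm_exp]; simp) (UpperHalfPlane.ofComplex ⟨0, y⟩),
    intervalIntegral_selbergGen_vadd_mul ψ m n hy,
    tsum_integral_redRows_selbergGen hΓ hd hneg hper hTa hψc hσ hψ hm n hy]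

end Selberg







/-! ## U. Unfolding `∫_F E_𝔞(z | p) f(z) dμ` into the strip (Motohashi (2.1.7), Iwaniec Lemma 3.3 for Poincaré series) -/

section Unfolding

open scoped Pointwise Real
open _root_.MeasureTheory Set Filter

variable {σa : SL(2, ℝ)}

/-- **The summand of the Poincaré series at a group element**: for `γ' ∈ σ⁻¹Γσ` (as an element of
`GL₂`), `p(γ' w) = p(ω_r w)` with `r` the row of `γ'` and `ω_r` the chosen lift (`1`-periodic `p`). [folklore] -/
theorem gen_conj_smul_eq_rowLift
    (hΓ : Γ ≤ (Matrix.SpecialLinearGroup.toGL : SL(2, ℝ) →* GL (Fin 2) ℝ).range)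
    (hd : IsDiscreteSubgroup Γ) (hneg : (-1 : GL (Fin 2) ℝ) ∈ Γ)
    (hper : (ConjAct.toConjAct (Matrix.SpecialLinearGroup.toGL σa : GL (Fin 2) ℝ)⁻¹ • Γ).strictPeriods =
      AddSubgroup.zmultiples (1 : ℝ))
    {p : ℍ → ℂ} (hp1 : ∀ w : ℍ, p ((1 : ℝ) +ᵥ w) = p w)
    {γ' : GL (Fin 2) ℝ} (hγ' : γ' ∈ ConjAct.toConjAct (Matrix.SpecialLinearGroup.toGL σa : GL (Fin 2) ℝ)⁻¹ • Γ)
    (w : ℍ) :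
    p (γ' • w) = p (rowLift Γ σa σa ((γ' : Matrix (Fin 2) (Fin 2) ℝ) 1) • w) := by
  obtain ⟨ω', hω', rfl⟩ := (mem_conj_iff_exists hΓ).mp hγ'
  have hr : ((Matrix.SpecialLinearGroup.toGL ω' : GL (Fin 2) ℝ) : Matrix (Fin 2) (Fin 2) ℝ) 1 =
      (ω' : Matrix (Fin 2) (Fin 2) ℝ) 1 := rfl
  rw [hr, toGL_smul_eq]
  have hl := rowLift_mem_and_row (σa := σa) (σb := σa) (Γ := Γ) ⟨ω', hω', rfl⟩
  exact gen_smul_eq_of_row_eq hΓ hd hneg hper hp1 hl.1 hω' hl.2.symm w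

/-- **The unfolding identity for Poincaré series, pointwise**: for `f` automorphic and `p` `1`-periodic,
`Σ_{γ ∈ Γ} 𝟙_P(σ_𝔞⁻¹γz) p(σ_𝔞⁻¹γz) f(γz) = 2 E_𝔞(z | p) f(z)` (`P = {0 ≤ Re < 1}`): each coset
`Γ_𝔞γ` has exactly one element per sign landing in the strip (the tree's `tsum_indicator_strip_eq`).
[cite: Iwaniec2002, §3.2 Lemma 3.3 (proof: "the sets `σ_𝔞⁻¹γF` cover the strip once"), PDF p. 44] -/
theorem tsum_strip_gen_eq_cusp
    (hΓ : Γ ≤ (Matrix.SpecialLinearGroup.toGL : SL(2, ℝ) →* GL (Fin 2) ℝ).range)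
    (hd : IsDiscreteSubgroup Γ) (hneg : (-1 : GL (Fin 2) ℝ) ∈ Γ)
    (hper : (ConjAct.toConjAct (Matrix.SpecialLinearGroup.toGL σa : GL (Fin 2) ℝ)⁻¹ • Γ).strictPeriods =
      AddSubgroup.zmultiples (1 : ℝ))
    {p : ℍ → ℂ} (hp1 : ∀ w : ℍ, p ((1 : ℝ) +ᵥ w) = p w) {f : ℍ → ℂ} (hfa : IsAutomorphic Γ f) (z : ℍ) :
    ∑' γ : Γ, (cuspStrip 0).indicator (fun _ => (1 : ℂ)) (σa⁻¹ • (γ : GL (Fin 2) ℝ) • z) *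
        (p (σa⁻¹ • (γ : GL (Fin 2) ℝ) • z) * f ((γ : GL (Fin 2) ℝ) • z)) =
      2 * (poincare Γ σa p z * f z) := by
  set S : GL (Fin 2) ℝ := Matrix.SpecialLinearGroup.toGL σa with hS
  set Γ' : Subgroup (GL (Fin 2) ℝ) := ConjAct.toConjAct S⁻¹ • Γ with hΓ'
  have hΓ'le : Γ' ≤ (Matrix.SpecialLinearGroup.toGL : SL(2, ℝ) →* GL (Fin 2) ℝ).range := by
    rw [hΓ', hS, ← map_inv]; exact conj_le_range hΓ σa⁻¹
  have hd' : IsDiscreteSubgroup Γ' := hd.conj _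
  have e1 : ∀ w : ℍ, σa⁻¹ • w = S⁻¹ • w := fun w => by rw [hS, ← map_inv]; rfl
  set z' : ℍ := σa⁻¹ • z with hz'
  -- the row function
  set G : (Fin 2 → ℝ) → ℂ := fun r => p (rowLift Γ σa σa r • z') * f z with hG
  have h := tsum_indicator_strip_eq hΓ'le hd' hper G z'
  -- reindex `Γ ≃ Γ'` on the left
  rw [← (conjEquiv S).tsum_eq] at h
  have eL : ∀ γ : Γ, (cuspStrip 0).indicator (fun _ => (1 : ℂ)) (σa⁻¹ • (γ : GL (Fin 2) ℝ) • z) *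
      (p (σa⁻¹ • (γ : GL (Fin 2) ℝ) • z) * f ((γ : GL (Fin 2) ℝ) • z)) =
      (cuspStrip 0).indicator (fun _ => (1 : ℂ)) (((conjEquiv S γ : Γ') : GL (Fin 2) ℝ) • z') *
        G ((((conjEquiv S γ : Γ') : GL (Fin 2) ℝ) : Matrix (Fin 2) (Fin 2) ℝ) 1) := by
    intro γ
    have e : ((conjEquiv S γ : Γ') : GL (Fin 2) ℝ) • z' = σa⁻¹ • (γ : GL (Fin 2) ℝ) • z := by
      rw [coe_conjEquiv, hz', e1, e1, mul_smul, mul_smul, smul_inv_smul]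
    rw [e]
    simp only [hG]
    rw [hfa _ γ.2, ← e, gen_conj_smul_eq_rowLift hΓ hd hneg hper hp1 (conjEquiv S γ).2]
  rw [tsum_congr eL, h]
  -- the right side: rows of `Γ'` are the pair rows
  rw [tsum_congr_set_coe G (rows_conj_eq_pairRows hΓ σa)]
  simp only [hG]
  rw [tsum_mul_right, poincare, poincarePair]
  ring

/-- **`∫_F E_𝔞(z | p) f(z) dμ = ∫_ℍ 𝟙_P(w) p(w) f(σ_𝔞w) dμ(w)`** (Iwaniec's unfolding for Poincaré
series; Motohashi (2.1.7) "the unfolding method"): for `Γ ≤ SL₂(ℝ)` discrete, `-1 ∈ Γ`, `F` a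
fundamental domain, periods `ℤ` at `𝔞`, `p` `1`-periodic, `f` automorphic, and the strip function
`w ↦ 𝟙_P(w) p(w) f(σ_𝔞 w)` integrable on `ℍ`.
[cite: Iwaniec2002, Lemma 3.3 & (3.13), PDF p. 44; Motohashi1997, (2.1.7), PDF p. 38] -/
theorem setIntegral_poincare_mul
    (hΓ : Γ ≤ (Matrix.SpecialLinearGroup.toGL : SL(2, ℝ) →* GL (Fin 2) ℝ).range)
    (hneg : (-1 : GL (Fin 2) ℝ) ∈ Γ) (hd : IsDiscreteSubgroup Γ) {F : Set ℍ}
    (hF : IsHypFundamentalDomain Γ F)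
    (hper : (ConjAct.toConjAct (Matrix.SpecialLinearGroup.toGL σa : GL (Fin 2) ℝ)⁻¹ • Γ).strictPeriods =
      AddSubgroup.zmultiples (1 : ℝ))
    {p : ℍ → ℂ} (hp1 : ∀ w : ℍ, p ((1 : ℝ) +ᵥ w) = p w) {f : ℍ → ℂ} (hfa : IsAutomorphic Γ f)
    (hΦ : Integrable fun w : ℍ => (cuspStrip 0).indicator (fun _ => (1 : ℂ)) w * (p w * f (σa • w))) :
    ∫ z in F, poincare Γ σa p z * f z =
      ∫ w : ℍ, (cuspStrip 0).indicator (fun _ => (1 : ℂ)) w * (p w * f (σa • w)) := by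
  set Φ₀ : ℍ → ℂ := fun w => (cuspStrip 0).indicator (fun _ => (1 : ℂ)) w * (p w * f (σa • w)) with hΦ₀
  set Φ : ℍ → ℂ := fun v => Φ₀ (σa⁻¹ • v) with hΦdef
  have hΦi : Integrable Φ := integrable_comp_sl_inv_smul hΦ σa
  have hunf := setIntegral_tsum_smul_eq hΓ hneg hd.countable hF hΦi
  have hpt : ∀ z : ℍ, poincare Γ σa p z * f z = (1 / 2) * ∑' γ : Γ, Φ ((γ : GL (Fin 2) ℝ) • z) := by
    intro z
    have h := tsum_strip_gen_eq_cusp hΓ hd hneg hper hp1 hfa z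
    have e : (fun γ : Γ => Φ ((γ : GL (Fin 2) ℝ) • z)) = fun γ : Γ =>
        (cuspStrip 0).indicator (fun _ => (1 : ℂ)) (σa⁻¹ • (γ : GL (Fin 2) ℝ) • z) *
          (p (σa⁻¹ • (γ : GL (Fin 2) ℝ) • z) * f ((γ : GL (Fin 2) ℝ) • z)) := by
      funext γ
      simp only [hΦdef, hΦ₀, smul_inv_smul]
    rw [e, h]; ring
  simp_rw [hpt]
  rw [integral_const_mul, hunf, hΦdef, integral_comp_sl_inv_smul Φ₀ σa]
  ring

/-- The strip function in Euclidean coordinates: `g(z) = y⁻² 𝟙_{[0,1)}(x) H(x + iy)`. [folklore] -/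
def stripGen (H : ℍ → ℂ) (z : ℂ) : ℂ :=
  ((z.im ^ 2)⁻¹ : ℝ) • ((Set.Ico (0 : ℝ) 1).indicator (fun _ => (1 : ℂ)) z.re * H (UpperHalfPlane.ofComplex z))

/-- On `{Im z > 0}` it is the transport of `w ↦ 𝟙_P(w) H(w)`. [folklore] -/
theorem stripGen_eq (H : ℍ → ℂ) {z : ℂ} (hz : 0 < z.im) :
    stripGen H z = ((z.im ^ 2)⁻¹ : ℝ) •
      ((cuspStrip 0).indicator (fun _ => (1 : ℂ)) (UpperHalfPlane.ofComplex z) * H (UpperHalfPlane.ofComplex z)) := by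
  unfold stripGen
  have him : (UpperHalfPlane.ofComplex z).im = z.im := by rw [UpperHalfPlane.ofComplex_apply_of_im_pos hz]; rfl
  congr 2
  by_cases h : 0 ≤ z.re ∧ z.re < 1
  · rw [Set.indicator_of_mem (show z.re ∈ Set.Ico (0 : ℝ) 1 from h),
      Set.indicator_of_mem (show UpperHalfPlane.ofComplex z ∈ cuspStrip 0 from by
        rw [UpperHalfPlane.ofComplex_apply_of_im_pos hz]; exact ⟨h.1, h.2, hz⟩)]
  · rw [Set.indicator_of_notMem (show z.re ∉ Set.Ico (0 : ℝ) 1 from h),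
      Set.indicator_of_notMem (show UpperHalfPlane.ofComplex z ∉ cuspStrip 0 from fun h' => by
        rw [UpperHalfPlane.ofComplex_apply_of_im_pos hz] at h'; exact h ⟨h'.1, h'.2.1⟩)]

/-- **The strip integral in coordinates**: `∫_ℍ 𝟙_P H dμ = ∫₀^∞ y⁻² ∫₀¹ H(x + iy) dx dy` when the
coordinate function `stripGen H` is integrable on `{Im > 0}`. [cite: Iwaniec2002, (3.13)–(3.14), PDF p. 44] -/
theorem integral_strip_gen_eq {H : ℍ → ℂ} (hint : IntegrableOn (stripGen H) {z : ℂ | 0 < z.im}) :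
    ∫ w : ℍ, (cuspStrip 0).indicator (fun _ => (1 : ℂ)) w * H w =
      ∫ y in Set.Ioi (0 : ℝ), (((y ^ 2)⁻¹ : ℝ) : ℂ) *
        ∫ x in (0 : ℝ)..1, H (UpperHalfPlane.ofComplex ⟨x, y⟩) := by
  rw [integral_upperHalfPlane_eq_integral_complex]
  have e1 : ∫ z in {z : ℂ | 0 < z.im}, ((z.im ^ 2)⁻¹ : ℝ) •
      ((cuspStrip 0).indicator (fun _ => (1 : ℂ)) (UpperHalfPlane.ofComplex z) * H (UpperHalfPlane.ofComplex z)) =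
      ∫ z in {z : ℂ | 0 < z.im}, stripGen H z :=
    setIntegral_congr_fun UpperHalfPlane.isOpen_upperHalfPlaneSet.measurableSet fun z hz => (stripGen_eq H hz).symm
  rw [e1, setIntegral_upperHalf_eq_iterated _ hint]
  refine setIntegral_congr_fun measurableSet_Ioi fun y hy => ?_
  have hy' : (0 : ℝ) < y := hy
  unfold stripGen
  simp only [Complex.real_smul]
  rw [intervalIntegral.integral_of_le zero_le_one, integral_Ioc_eq_integral_Ioo, ← integral_Ico_eq_integral_Ioo,
    ← integral_const_mul, ← integral_indicator measurableSet_Ico]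
  refine integral_congr_ae (Filter.Eventually.of_forall fun x => ?_)
  simp only [Set.indicator_apply, Set.mem_Ico]
  split_ifs
  · ring
  · simp

/-- **Motohashi's (2.1.7) / Iwaniec's (3.13) for Poincaré series, in coordinates**:
`∫_F E_𝔞(z | p) f(z) dμ = ∫₀^∞ y⁻² ∫₀¹ p(x + iy) f(σ_𝔞(x + iy)) dx dy`.
[cite: Motohashi1997, (2.1.7), PDF p. 38; Iwaniec2002, Lemma 3.3 (3.13)–(3.14), PDF p. 44] -/
theorem setIntegral_poincare_mul_eq_iterated
    (hΓ : Γ ≤ (Matrix.SpecialLinearGroup.toGL : SL(2, ℝ) →* GL (Fin 2) ℝ).range)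
    (hneg : (-1 : GL (Fin 2) ℝ) ∈ Γ) (hd : IsDiscreteSubgroup Γ) {F : Set ℍ}
    (hF : IsHypFundamentalDomain Γ F)
    (hper : (ConjAct.toConjAct (Matrix.SpecialLinearGroup.toGL σa : GL (Fin 2) ℝ)⁻¹ • Γ).strictPeriods =
      AddSubgroup.zmultiples (1 : ℝ))
    {p : ℍ → ℂ} (hp1 : ∀ w : ℍ, p ((1 : ℝ) +ᵥ w) = p w) {f : ℍ → ℂ} (hfa : IsAutomorphic Γ f)
    (hint : IntegrableOn (stripGen fun w => p w * f (σa • w)) {z : ℂ | 0 < z.im}) :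
    ∫ z in F, poincare Γ σa p z * f z =
      ∫ y in Set.Ioi (0 : ℝ), (((y ^ 2)⁻¹ : ℝ) : ℂ) *
        ∫ x in (0 : ℝ)..1, p (UpperHalfPlane.ofComplex ⟨x, y⟩) * f (σa • UpperHalfPlane.ofComplex ⟨x, y⟩) := by
  have hΦ : Integrable fun w : ℍ => (cuspStrip 0).indicator (fun _ => (1 : ℂ)) w * (p w * f (σa • w)) := by
    rw [integrable_upperHalfPlane_iff_integrableOn_complex]
    refine hint.congr_fun (fun z hz => ?_) UpperHalfPlane.isOpen_upperHalfPlaneSet.measurableSet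
    exact stripGen_eq _ hz
  rw [setIntegral_poincare_mul hΓ hneg hd hF hper hp1 hfa hΦ, integral_strip_gen_eq hint]

/-- `|p(z)| = |ψ(y)| e^{-2πmy}` for Selberg's generating function. [folklore] -/
theorem norm_selbergGen_eq (ψ : ℝ → ℂ) (m : ℤ) (v : ℍ) :
    ‖selbergGen ψ m v‖ = ‖ψ v.im‖ * Real.exp (-(2 * π * m * v.im)) := by
  unfold selbergGen
  rw [norm_mul, Complex.norm_exp]
  congr 2
  have e : 2 * (π : ℂ) * Complex.I * m * (v : ℂ) = ((2 * π * m : ℝ) : ℂ) * (Complex.I * (v : ℂ)) := by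
    push_cast; ring
  rw [e, Complex.re_ofReal_mul, Complex.I_mul_re, UpperHalfPlane.coe_im]
  ring

/-- The upper half-plane as the preimage of `ℝ × (0, ∞)` under `ℂ ≃ ℝ × ℝ`. [folklore] -/
theorem upperHalf_eq_preimage_realProd :
    {z : ℂ | 0 < z.im} = Complex.measurableEquivRealProd ⁻¹' (Set.univ ×ˢ Set.Ioi (0 : ℝ)) := by
  ext z; simp [Complex.measurableEquivRealProd]

/-- **Integrability of the Selberg strip function** `z ↦ y⁻² 𝟙_{[0,1)}(x) ψ(y) e(mz) f(σ z)` on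
`{Im > 0}`, for `ψ` continuous on `(0, ∞)` with `∫₀^∞ |ψ(y)| e^{-2πmy} y⁻² dy < ∞` and `f ∘ σ`
continuous and bounded (product majorant `𝟙_{[0,1)}(x) · |ψ(y)|e^{-2πmy}y⁻² B`).
[cite: Motohashi1997, §2.1 (proof of (2.1.7)), PDF p. 38] -/
theorem integrableOn_stripGen_selbergGen {ψ : ℝ → ℂ} (hψc : ContinuousOn ψ (Ioi 0)) (m : ℤ)
    (hψi : IntegrableOn (fun y : ℝ => ‖ψ y‖ * Real.exp (-(2 * π * m * y)) * (y ^ 2)⁻¹) (Ioi 0))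
    (σ : SL(2, ℝ)) {f : ℍ → ℂ} (hfc : Continuous f) {B : ℝ} (hfB : ∀ w : ℍ, ‖f (σ • w)‖ ≤ B) :
    IntegrableOn (stripGen fun w => selbergGen ψ m w * f (σ • w)) {z : ℂ | 0 < z.im} := by
  set U : Set ℂ := {z : ℂ | 0 < z.im} with hU
  have hmeasU : MeasurableSet U := UpperHalfPlane.isOpen_upperHalfPlaneSet.measurableSet
  have hB : 0 ≤ B := (norm_nonneg _).trans (hfB UpperHalfPlane.I)
  -- the majorant in product form
  set h : ℝ → ℝ := fun y => ‖ψ y‖ * Real.exp (-(2 * π * m * y)) * (y ^ 2)⁻¹ * B with hh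
  set G : ℝ × ℝ → ℝ := fun q => (Set.Ico (0 : ℝ) 1).indicator (fun _ => (1 : ℝ)) q.1 * h q.2 with hG
  have hi : Integrable (fun x : ℝ => (Set.Ico (0 : ℝ) 1).indicator (fun _ => (1 : ℝ)) x) := by
    rw [integrable_indicator_iff measurableSet_Ico]
    exact integrableOn_const (by simp)
  have hhi : Integrable h (volume.restrict (Ioi 0)) := hψi.mul_const B
  have hGi' : Integrable G (volume.prod (volume.restrict (Ioi (0 : ℝ)))) := hi.mul_prod hhi
  have hGi : IntegrableOn G (Set.univ ×ˢ Set.Ioi (0 : ℝ)) (volume.prod volume) := by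
    rw [IntegrableOn, ← Measure.prod_restrict, Measure.restrict_univ]
    exact hGi'
  set g : ℂ → ℝ := G ∘ Complex.measurableEquivRealProd with hg
  have hgi : IntegrableOn g U := by
    rw [hU, upperHalf_eq_preimage_realProd, hg]
    exact ((Complex.volume_preserving_equiv_real_prod).integrableOn_comp_preimage
      Complex.measurableEquivRealProd.measurableEmbedding).mpr hGi
  -- measurability of the strip function
  set K : ℍ → ℂ := fun w => selbergGen ψ m w * f (σ • w) with hK
  have hKc : Continuous K := (continuous_selbergGen hψc m).mul (hfc.comp (continuous_const_smul σ))
  have hae : AEStronglyMeasurable (stripGen K) (volume.restrict U) := by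
    unfold stripGen
    refine AEStronglyMeasurable.smul (𝕜 := ℝ) ?_ (AEStronglyMeasurable.mul ?_ ((continuousOn_comp_ofComplex hKc).aestronglyMeasurable hmeasU))
    · exact (Complex.continuous_im.measurable.pow_const 2).inv.aestronglyMeasurable
    · exact ((measurable_const.indicator measurableSet_Ico).comp Complex.measurable_re).aestronglyMeasurable
  refine Integrable.mono' hgi hae (ae_restrict_of_forall_mem hmeasU fun z hz => ?_)
  have hz' : 0 < z.im := hz
  have him : (UpperHalfPlane.ofComplex z).im = z.im := by
    rw [UpperHalfPlane.ofComplex_apply_of_im_pos hz']; rfl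
  unfold stripGen
  rw [norm_smul, norm_mul, norm_mul, Real.norm_of_nonneg (by positivity), norm_indicator_eq_indicator_norm,
    norm_selbergGen_eq, him]
  have hgz : g z = (Set.Ico (0 : ℝ) 1).indicator (fun _ => (1 : ℝ)) z.re * h z.im := rfl
  rw [hgz, hh]
  by_cases hx : z.re ∈ Set.Ico (0 : ℝ) 1
  · rw [Set.indicator_of_mem hx, Set.indicator_of_mem hx, norm_one, one_mul, one_mul]
    have hf := hfB (UpperHalfPlane.ofComplex z)
    have h0 : 0 ≤ ‖ψ z.im‖ * Real.exp (-(2 * π * m * z.im)) := by positivity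
    calc (z.im ^ 2)⁻¹ * (‖ψ z.im‖ * Real.exp (-(2 * π * m * z.im)) * ‖f (σ • UpperHalfPlane.ofComplex z)‖)
        ≤ (z.im ^ 2)⁻¹ * (‖ψ z.im‖ * Real.exp (-(2 * π * m * z.im)) * B) := by gcongr
      _ = ‖ψ z.im‖ * Real.exp (-(2 * π * m * z.im)) * (z.im ^ 2)⁻¹ * B := by ring
  · rw [Set.indicator_of_notMem hx, Set.indicator_of_notMem hx]
    simp

/-- **Motohashi (2.1.7) at a cusp of a general group.** For the Selberg–Poincaré series
`E_𝔞m(z | ψ) = Σ_{γ ∈ Γ_𝔞 \ Γ} ψ(Im σ_𝔞⁻¹γz) e(m σ_𝔞⁻¹γz)` (`m ≥ 0`) and a continuous automorphic `f`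
bounded in the frame of `𝔞`, with `∫₀^∞ |ψ(y)| e^{-2πmy} y⁻² dy < ∞`:

  `∫_F E_𝔞m(z | ψ) f(z) dμ(z) = ∫₀^∞ ψ(y) e^{-2πmy} (∫₀¹ f(σ_𝔞(x + iy)) e(mx) dx) y⁻² dy`

("`⟨f, P_m(·, s̄)⟩ = ∫₀^∞ ∫ f(z) e(-m z̄) y^{s-2} dx dy` — this procedure is the unfolding method";
apply to `f̄` for the inner product; the inner integral is the `(-m)`-th Fourier mode of `f` at `𝔞`).
[cite: Motohashi1997, (2.1.7), PDF p. 38; Iwaniec2002, Lemma 3.3 (3.13)–(3.14), PDF p. 44] -/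
theorem setIntegral_poincare_selbergGen_mul
    (hΓ : Γ ≤ (Matrix.SpecialLinearGroup.toGL : SL(2, ℝ) →* GL (Fin 2) ℝ).range)
    (hneg : (-1 : GL (Fin 2) ℝ) ∈ Γ) (hd : IsDiscreteSubgroup Γ) {F : Set ℍ}
    (hF : IsHypFundamentalDomain Γ F)
    (hper : (ConjAct.toConjAct (Matrix.SpecialLinearGroup.toGL σa : GL (Fin 2) ℝ)⁻¹ • Γ).strictPeriods =
      AddSubgroup.zmultiples (1 : ℝ))
    {ψ : ℝ → ℂ} (hψc : ContinuousOn ψ (Ioi 0)) (m : ℤ)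
    (hψi : IntegrableOn (fun y : ℝ => ‖ψ y‖ * Real.exp (-(2 * π * m * y)) * (y ^ 2)⁻¹) (Ioi 0))
    {f : ℍ → ℂ} (hfa : IsAutomorphic Γ f) (hfc : Continuous f) {B : ℝ} (hfB : ∀ w : ℍ, ‖f (σa • w)‖ ≤ B) :
    ∫ z in F, poincare Γ σa (selbergGen ψ m) z * f z =
      ∫ y in Set.Ioi (0 : ℝ), (((y ^ 2)⁻¹ : ℝ) : ℂ) * (ψ y * Complex.exp (-(2 * π * m * y))) *
        ∫ x in (0 : ℝ)..1, f (σa • ((x : ℝ) +ᵥ UpperHalfPlane.ofComplex ⟨0, y⟩)) *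
          Complex.exp (2 * π * Complex.I * m * x) := by
  rw [setIntegral_poincare_mul_eq_iterated hΓ hneg hd hF hper (selbergGen_vadd_one ψ m) hfa
    (integrableOn_stripGen_selbergGen hψc m hψi σa hfc hfB)]
  refine setIntegral_congr_fun measurableSet_Ioi fun y hy => ?_
  have hy' : (0 : ℝ) < y := hy
  rw [mul_assoc, ← intervalIntegral.integral_const_mul (ψ y * Complex.exp (-(2 * π * m * y)))]
  congr 1
  refine intervalIntegral.integral_congr fun x _ => ?_
  have hpt : UpperHalfPlane.ofComplex (⟨x, y⟩ : ℂ) = ((x : ℝ) +ᵥ UpperHalfPlane.ofComplex ⟨0, y⟩ : ℍ) := by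
    rw [UpperHalfPlane.ofComplex_apply_of_im_pos (z := (⟨x, y⟩ : ℂ)) hy',
      UpperHalfPlane.ofComplex_apply_of_im_pos (z := (⟨0, y⟩ : ℂ)) hy']
    ext1
    rw [UpperHalfPlane.coe_vadd]
    apply Complex.ext <;> simp
  rw [hpt]
  unfold selbergGen
  rw [UpperHalfPlane.vadd_im, coe_real_vadd_ofComplex _ hy']
  have him : (UpperHalfPlane.ofComplex (⟨0, y⟩ : ℂ)).im = y := by
    rw [UpperHalfPlane.ofComplex_apply_of_im_pos (z := (⟨0, y⟩ : ℂ)) hy']; rfl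
  rw [him]
  have e : Complex.exp (2 * π * Complex.I * m * ((x : ℂ) + Complex.I * y)) =
      Complex.exp (-(2 * π * m * y) : ℂ) * Complex.exp (2 * π * Complex.I * m * x) := by
    rw [← Complex.exp_add]
    congr 1
    have hI : Complex.I * Complex.I = -1 := Complex.I_mul_I
    linear_combination (2 * (π : ℂ) * (m * y)) * hI
  rw [e]
  ring

end Unfolding





end Fuchsian

end Literature.NumberTheory.Automorphic
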